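import Summits.CriticalPhenomena.Ising3DConformalLimit.Theses.LinkingParityCircles
import Summits.CriticalPhenomena.Ising3DConformalLimit.Theorems.MoebiusLimitExists.Negative.FreeTranslations
import Summits.CriticalPhenomena.Ising3DConformalLimit.Theorems.RotationUpgradeFromTwoPoint.Negative.ContinuityFree
import Summits.CriticalPhenomena.Ising3DConformalLimit.Theorems.HyperoctahedralRPLimitRotationInvariant
import Summits.CriticalPhenomena.Ising3DConformalLimit.Theorems.HyperoctahedralRPHRP2Rigidity
import Summits.CriticalPhenomena.Ising3DConformalLimit.Theorems.LinkingParityCirclesSpinRatioMoebiusStubCellLimitTranslate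
import Summits.CriticalPhenomena.Ising3DConformalLimit.Theorems.LinkingParityCirclesSpinRatioMoebiusStubCellLimitContinuous
import Summits.CriticalPhenomena.Ising3DConformalLimit.Theorems.LinkingParityCirclesSpinRatioMoebiusStubTwoPointOfRatioLimit
import Summits.CriticalPhenomena.Ising3DConformalLimit.Theorems.LinkingParityCirclesSpinRatioMoebiusStubScalingLimitOfRatioLimit
import Summits.CriticalPhenomena.Ising3DConformalLimit.Theorems.LinkingParityCirclesSpinRatioMoebiusRatioLimitExistsOfCCI
import Summits.CriticalPhenomena.Ising3DConformalLimit.Theorems.LinkingParityCirclesSpinRatioMoebiusStubProdPairsLe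
import Summits.CriticalPhenomena.Ising3DConformalLimit.Theorems.LinkingParityCirclesSpinRatioMoebiusStubRatioLimitOfScalingLimit
import Summits.CriticalPhenomena.Ising3DConformalLimit.Theorems.LinkingParityCirclesSpinRatioMoebiusStubRatioInversionOfCCI
import Summits.CriticalPhenomena.Ising3DConformalLimit.Theorems.LinkingParityCirclesSpinRatioMoebiusStubRatioOfCovariantFamily
import Summits.CriticalPhenomena.Ising3DConformalLimit.Theorems.LinkingParityCirclesSpinRatioMoebiusStubInversionCovariantOfInvariantRatios
import Summits.CriticalPhenomena.Ising3DConformalLimit.Theorems.LinkingParityCirclesSpinRatioMoebiusStubTelescopingLimitOfScalingLimit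
import Summits.CriticalPhenomena.Ising3DConformalLimit.Theorems.LinkingParityCirclesSpinRatioMoebiusStubCCIRatioRotationOfLimit
import Summits.CriticalPhenomena.Ising3DConformalLimit.Theorems.LinkingParityCirclesSpinRatioMoebiusStubCCIRatioInversionOfLimit
import Summits.CriticalPhenomena.Ising3DConformalLimit.Theses.HyperoctahedralRP
import Summits.CriticalPhenomena.Ising3DConformalLimit.Theses.CurrentConnectionInvariance
import Summits.CriticalPhenomena.Ising3DConformalLimit.Theses.EnergyNotSigmaSquared
import Summits.CriticalPhenomena.Ising3DConformalLimit.Theses.PrimaryAtInfinity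
import Summits.CriticalPhenomena.Ising3DConformalLimit.Theorems.MoebiusLimitExists.Negative.MeshContinuity
import Summits.CriticalPhenomena.Ising3DConformalLimit.Theorems.MoebiusLimitExists.Negative.CruxInversionOnly
import Literature.Probability.LatticeModels.HighDimPointwiseTriviality
import Literature.Probability.LatticeModels.ScalingLimit3D
import HarnessLib

/-!
# Crux `LinkingParityCircles.SpinRatioMoebius` (stmt-CriticalPhenomena-4530) — skeleton of line `registered`
# (lead prover-line-stmt-CriticalPhenomena-4530-0, reshape 1; continuation lead …-4530-c1-0, reshape 2, §2b/§9)

The crux (rank 4 of route `LinkingParityCircles`, "the k = 0 corner"): there is a family `q : CorrFamily 3`,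
Möbius covariant with weight `0` (INVARIANT under translations, `O(3)`, dilations and the unit inversion), such
that for every `m` the weight-free spin pairing ratio
`Q^δ_m(x) = ⟨σ_{[x₀/δ]}⋯σ_{[x_{2m−1}/δ]}⟩⁺_{β_c} / ∏_{j<m} ⟨σ_{[x_j/δ]}σ_{[x_{j+m}/δ]}⟩⁺_{β_c}` (= `pairingRatio m δ x`)
converges to `q (m+m)` as `δ → 0⁺`, locally uniformly on `NonCoincident 3 (m+m)`.

## Reshape 1 (this lead): EUCLIDEAN INVARIANCE IS FREE — two open stubs remain (state after cycle 1)

The birth skeleton cut the crux along the generators of Möb(3) into four lattice statements (convergence,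
translation, rotation, inversion).  This reshape PROVES that the translation and rotation statements follow from
convergence alone, using structure already landed in the tree; all four provable stubs are now LANDED:

* `stub_cellLimitTranslate` (p148702, `Theorems/LinkingParityCirclesSpinRatioMoebiusStubCellLimitTranslate.lean`):
  translation invariance of any mesh limit of a lattice-shift-invariant family is automatic (the tree's
  `limit_translate` mechanism: along `δ_k = t/(k+1)` translation by `t m̂` is a lattice translation);
* `stub_cellLimitContinuous` (p151155, `…StubCellLimitContinuous.lean`): continuity of such limits is automatic (the
  tree's cellmate-shift pigeonhole `exists_cellmate_shift`);
* `stub_twoPointOfRatioLimit` (p152013, `…StubTwoPointOfRatioLimit.lean` with helpers `…TwoPointPrelim.lean` p151052,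
  `…TwoPointConfigs.lean` p151749): from the ratio limit at level `m = 2` alone the PINNED two-point function
  `⟨σ_{[x/δ]}σ_{[y/δ]}⟩ / ⟨σ₀σ_{⌊1/δ⌋e₀}⟩` has a locally uniform limit `ψ(y − x)`, `ψ` continuous, positive and
  homogeneous of some degree `−2Δ` (exact identity `K_δ² Q^δ_2(0,δk,u,u+δk) = Q^δ_2(0,u,δk,u+δk)`, `k = ⌊1/δ⌋eᵢ`; GKS
  `Q ≥ 1`; continuity of `q4`; the continuous Cauchy equation);
* `stub_scalingLimitOfRatioLimit` (p151899, `…StubScalingLimitOfRatioLimit.lean`): the pinned rescaled correlators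
  `ρ(δ)ⁿ⟨∏σ_{[xᵢ/δ]}⟩`, `ρ(δ)² = 1/⟨σ₀σ_{⌊1/δ⌋e₀}⟩`, HAVE a pointwise scaling limit `S` (`S_{2m} = q_{2m} ∏_j ψ(x_{m+j} − x_j)`,
  `S_odd = 0`), normalised, non-degenerate, translation invariant, scale covariant with dimension `Δ`;
* and EVERY such limit is `O(3)`-invariant at all orders by the landed theorems of route `HyperoctahedralRP`
  (`HRP2Rigidity_of`, item 1979; `limitRotationInvariant_proof`, item 1980 via 8367), so `q_{2m} = S_{2m}/∏S_2` is
  `O(3)`-invariant (`ratioLimit_rotate`).  Dilations were already free (`pairingRatio_smul`).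

What remains OPEN is exactly: `stub_ratioLimitExists` (existence = uniqueness of the ratio limits; XL; ⇐ item
stmt-CriticalPhenomena-4841 `CurrentConnectionInvariance.RatioLimit`) and `stub_ratioInversion` (asymptotic invariance
under the unit inversion on the lattice — conformal invariance proper; XL; ⇐ `stub_ratioLimitExists` ∧ item
stmt-CriticalPhenomena-1982 `HyperoctahedralRP.InversionUpgradeNormalised`, kernel-checked in §8:
`SpinRatioMoebius_of_ratioLimitExists_of_inversionUpgrade`).

## Cycle 2 (continuation lead c1): the crux PINNED — landed, sorry-free, in the tree

All eight pinning stubs (7–14) landed (p155354 p155374 p155919 p155409 p156824 p156813 p156812 p156823), plus the glue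
`Theorems/LinkingParityCirclesSpinRatioMoebiusPinnedLimit.lean` (p157210, `pinnedLimit_of_ratioLimits`), the EQUIVALENCES
`Theorems/LinkingParityCirclesSpinRatioMoebiusEquivalences.lean` (p157687: `SpinRatioMoebius_iff_moebiusLimit` — crux ⇔ item 1344;
`SpinRatioMoebius_iff_CCI_items` — crux ⇔ 4841 ∧ 4840; `ratioLimits_iff_CCIRatioLimit` — Stub 1 ⇔ 4841; `CCIRatioRotation_of_CCIRatioLimit`
— 4841 ⇒ 4842; `SpinRatioMoebius_of_ratioLimits_of_inversionUpgrade` — crux ⇐ Stub 1 ∧ 1982; `SpinRatioMoebius_of_conformalLimit` —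
the conjunct ⇒ crux) and the existence avatars `Theorems/LinkingParityCirclesSpinRatioMoebiusExistenceAvatars.lean` (p157890:
Stub 1 ⇔ 4841 ⇔ 4738 `WeylWindow.LimitExists` ⇔ 5355 ⇔ 1981; crux ⇔ 4738 ∧ 4840; 1344 ⇔ 4738 ∧ 4840).  What remains open is
exactly the open problem: Stub 1 (= bare existence of a non-degenerate critical scaling limit on `ℤ³`, item 4738 and its avatars)
and Stub 2 (⇐ Stub 1 ∧ item 4840, ⇐ Stub 1 ∧ item 1982).

## Cycle 3 (continuation lead c2): the line is TIGHT — landed `SpinRatioMoebius ⇔ stub_ratioLimitExists ∧ stub_ratioInversion`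

Re-verified against the current tree (rc 0, sorries 2 = the two OPEN stubs) and re-registered (sha of this file).  The one
missing certificate is landed in `Theorems/LinkingParityCirclesSpinRatioMoebiusLineTightness.lean` (registered sub-goals
`SpinRatioMoebius_iff_ratioLimits_and_ratioInversion` and `ratioInversion_iff_CCIRatioInversion_of_ratioLimits`): the crux is
EQUIVALENT to the conjunction of the two open stubs (each is NECESSARY — Stub 2 follows from the crux directly by pointwise
convergence to an inversion invariant limit), and given Stub 1, Stub 2 ⇔ item 4840.  So every piece of this line sits on an
existing open item: Stub 1 ⇔ 4841 ⇔ 4738 ⇔ 5355 ⇔ 1981, Stub 2 ⇔ 4840 (given Stub 1), crux ⇔ 1344 ⇔ Stub 1 ∧ Stub 2 (§11).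
The equivalent items 1344 / 4738 / 4840 / 4841 / 1981 / 5355 / 1982 were re-read (2026-08-17T12:12Z): all OPEN, so nothing
moves through the landed equivalences.  No `Disproof.lean` exists for this crux.  wave: none (both open stubs are
kernel-checked equivalents of open items; three earlier waves returned stub-blocked).

## Composition

`SpinRatioMoebius_of : Sig.stub_ratioLimitExists → Sig.stub_ratioInversion → Sig.stub_cellLimitTranslate →
Sig.stub_cellLimitContinuous → Sig.stub_twoPointOfRatioLimit → Sig.stub_scalingLimitOfRatioLimit →
LinkingParityCircles.SpinRatioMoebius` (sorry-free) concludes the route decl BY NAME; `SpinRatioMoebius_of_stubs`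
feeds it the two OPEN registered stubs and the four LANDED ones.  Corollaries recorded for the planners: the birth
stubs `Sig.stub_ratioTranslation` and `Sig.stub_ratioRotation` FOLLOW from `Sig.stub_ratioLimitExists` (§7), and the
crux follows from `Sig.stub_ratioLimitExists ∧ HyperoctahedralRP.InversionUpgradeNormalised`, hence from the two OPEN
sibling items `CurrentConnectionInvariance.RatioLimit` (4841, via the landed bridge `ratioLimitExists_of_CCIRatioLimit`) and
`HyperoctahedralRP.InversionUpgradeNormalised` (1982) alone (§8, `SpinRatioMoebius_of_CCIRatioLimit_of_inversionUpgrade`).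

Disproof used: none exists for this crux (`ledger crux ls`, 2026-08-17).  Wave 1 verdicts (stub-workers, this
lead's session): `stub_ratioLimitExists` blocked on open item 4841 (or 5355 `PrimaryAtInfinity.ExistsRegularLimit`);
`stub_ratioRotation` (birth form) blocked on open item 1981 — superseded by this reshape.

## Reshape 2 (continuation lead c1): PINNING the two open stubs to the existing items of the sibling routes

The two open stubs are the open problem itself; reshape 2 does not pretend otherwise.  It adds four PROVABLE-NOW
stubs (§2b) whose compositions (§9) make the position of the crux in the DAG of existing items kernel-checked:

* `stub_prodPairsLe` — iterated GKS II: `∏_j ⟨σ_{y_j}σ_{y_{j+m}}⟩ ≤ ⟨∏σ_{yᵢ}⟩` at injective lattice configurations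
  (`Q ≥ 1`; positivity of every ratio limit on the locus);
* `stub_ratioLimitOfScalingLimit` — `stub_ratioLimitExists` follows from ANY non-degenerate pointwise scaling limit
  `(ρ, S)` of the critical correlators, with the explicit limit `q_{2m} = S_{2m}/∏_j S_2(x_j, x_{j+m})` (mesh continuity
  of limits, `LimitMeshContinuity.continuousOn_limit`, and locally uniform limit algebra) — in-edges from items
  stmt-1981 `HyperoctahedralRP.ExistsScaleCovariantLimit`, stmt-5355 `PrimaryAtInfinity.ExistsRegularLimit`,
  stmt-1344 `MoebiusLimit`, and from the conjunct itself;
* `stub_ratioInversionOfCCI` — `stub_ratioInversion` follows from `stub_ratioLimitExists` and item stmt-4840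
  `CurrentConnectionInvariance.RatioInversionInvariance` (induction on the level through the exact identity
  `Q_{m+1}(x) = Q_m(y)/R_{2m}(z)` of the landed 4841 bridge, limits `≥ 1` by `stub_prodPairsLe`), so that
  `SpinRatioMoebius ⇐ 4841 ∧ 4840` inside route `CurrentConnectionInvariance` ALONE (kill criterion (d));
* `stub_ratioOfCovariantFamily` — for a Möbius covariant family `S` of weight `Δ` the pairing quotients
  `S_{2m}/∏_j S_2(pairs)` are Möbius INVARIANT (the pairing covers every index once), whence
  `SpinRatioMoebius ⇐ MoebiusLimit` (item 1344 = the conjunct minus (iii)) and `SpinRatioMoebius ⇐ Ising3DConformalLimit`: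
  the crux is NECESSARY for the summit conjunct (honest-route certificate).
-/

noncomputable section

namespace Summit.CriticalPhenomena.Ising3DConformalLimit.Cruxes.SpinRatioMoebius.Birth

open Literature.Probability.LatticeModels
open Filter Topology
open Summit.CriticalPhenomena.Ising3DConformalLimit.Theses
open Summit.CriticalPhenomena.Ising3DConformalLimit.MoebiusLimitExistsNegative
open Summit.CriticalPhenomena.Ising3DConformalLimit.Theorems.MoebiusLimitOfTwoPointLaw.Negative
  (latticeApprox_smul tendsto_div_const_nhdsGT)

/-! ## §0 The lattice pairing ratio (verbatim the approximant of the crux) -/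

/-- `pairingRatio m δ x = ⟨σ_{[x₀/δ]}⋯σ_{[x_{2m-1}/δ]}⟩⁺_{β_c(3)} / ∏_{j<m} ⟨σ_{[x_j/δ]}σ_{[x_{j+m}/δ]}⟩⁺_{β_c(3)}`:
the weight-free spin pairing ratio of the crux at mesh `δ` (no renormalisation `ρ`: it cancels). -/
def pairingRatio (m : ℕ) (δ : ℝ) (x : Fin (m + m) → EuclideanSpace ℝ (Fin 3)) : ℝ :=
  criticalCorr 3 (m + m) (fun i => latticeApprox δ (x i)) /
    ∏ j : Fin m, criticalCorr 3 2 ![latticeApprox δ (x (Fin.castAdd m j)), latticeApprox δ (x (Fin.natAdd m j))]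

/-! ## §1 The stub statements as named propositions (verbatim the registered signatures) -/

/-- Statement of `stub_ratioLimitExists` (OPEN). -/
def Sig.stub_ratioLimitExists : Prop :=
  ∃ q : Literature.Probability.LatticeModels.CorrFamily 3, ∀ m : ℕ, TendstoLocallyUniformlyOn (fun (δ : ℝ) (x : Fin (m + m) → EuclideanSpace ℝ (Fin 3)) => Literature.Probability.LatticeModels.criticalCorr 3 (m + m) (fun i => Literature.Probability.LatticeModels.latticeApprox δ (x i)) / ∏ j : Fin m, Literature.Probability.LatticeModels.criticalCorr 3 2 ![Literature.Probability.LatticeModels.latticeApprox δ (x (Fin.castAdd m j)), Literature.Probability.LatticeModels.latticeApprox δ (x (Fin.natAdd m j))]) (q (m + m)) (nhdsWithin 0 (Set.Ioi 0)) (Literature.Probability.LatticeModels.NonCoincident 3 (m + m))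

/-- Statement of `stub_ratioInversion` (OPEN). -/
def Sig.stub_ratioInversion : Prop :=
  ∀ (m : ℕ), ∀ x ∈ Literature.Probability.LatticeModels.NonCoincident 3 (m + m), (∀ i, x i ≠ 0) → Filter.Tendsto (fun δ : ℝ => Literature.Probability.LatticeModels.criticalCorr 3 (m + m) (fun i => Literature.Probability.LatticeModels.latticeApprox δ (EuclideanGeometry.inversion 0 1 (x i))) / (∏ j : Fin m, Literature.Probability.LatticeModels.criticalCorr 3 2 ![Literature.Probability.LatticeModels.latticeApprox δ (EuclideanGeometry.inversion 0 1 (x (Fin.castAdd m j))), Literature.Probability.LatticeModels.latticeApprox δ (EuclideanGeometry.inversion 0 1 (x (Fin.natAdd m j)))]) - Literature.Probability.LatticeModels.criticalCorr 3 (m + m) (fun i => Literature.Probability.LatticeModels.latticeApprox δ (x i)) / (∏ j : Fin m, Literature.Probability.LatticeModels.criticalCorr 3 2 ![Literature.Probability.LatticeModels.latticeApprox δ (x (Fin.castAdd m j)), Literature.Probability.LatticeModels.latticeApprox δ (x (Fin.natAdd m j))])) (nhdsWithin 0 (Set.Ioi 0)) (nhds 0)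

/-- Statement of `stub_cellLimitTranslate` (provable now; landed by this lead). -/
def Sig.stub_cellLimitTranslate : Prop :=
  ∀ (n : ℕ) (F : ℝ → (Fin n → EuclideanSpace ℝ (Fin 3)) → ℝ) (g : (Fin n → EuclideanSpace ℝ (Fin 3)) → ℝ), (∀ δ : ℝ, 0 < δ → ∀ (x : Fin n → EuclideanSpace ℝ (Fin 3)) (k : Literature.Probability.LatticeModels.Site 3), F δ (fun i => x i + δ • Literature.Probability.LatticeModels.siteVec k) = F δ x) → TendstoLocallyUniformlyOn F g (nhdsWithin 0 (Set.Ioi 0)) (Literature.Probability.LatticeModels.NonCoincident 3 n) → ∀ (v : EuclideanSpace ℝ (Fin 3)), ∀ x ∈ Literature.Probability.LatticeModels.NonCoincident 3 n, g (fun i => x i + v) = g x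

/-- Statement of `stub_cellLimitContinuous` (provable now; landed by this lead). -/
def Sig.stub_cellLimitContinuous : Prop :=
  ∀ (n : ℕ) (F : ℝ → (Fin n → EuclideanSpace ℝ (Fin 3)) → ℝ) (g : (Fin n → EuclideanSpace ℝ (Fin 3)) → ℝ), (∀ δ : ℝ, 0 < δ → ∀ x y : Fin n → EuclideanSpace ℝ (Fin 3), (∀ i j, ⌊x i j / δ⌋ = ⌊y i j / δ⌋) → F δ x = F δ y) → (∀ (v : EuclideanSpace ℝ (Fin 3)), ∀ x ∈ Literature.Probability.LatticeModels.NonCoincident 3 n, g (fun i => x i + v) = g x) → TendstoLocallyUniformlyOn F g (nhdsWithin 0 (Set.Ioi 0)) (Literature.Probability.LatticeModels.NonCoincident 3 n) → ContinuousOn g (Literature.Probability.LatticeModels.NonCoincident 3 n)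

/-- Statement of `stub_twoPointOfRatioLimit` (provable now). -/
def Sig.stub_twoPointOfRatioLimit : Prop :=
  ∀ (q4 : (Fin (2 + 2) → EuclideanSpace ℝ (Fin 3)) → ℝ), TendstoLocallyUniformlyOn (fun (δ : ℝ) (x : Fin (2 + 2) → EuclideanSpace ℝ (Fin 3)) => Literature.Probability.LatticeModels.criticalCorr 3 (2 + 2) (fun i => Literature.Probability.LatticeModels.latticeApprox δ (x i)) / ∏ j : Fin 2, Literature.Probability.LatticeModels.criticalCorr 3 2 ![Literature.Probability.LatticeModels.latticeApprox δ (x (Fin.castAdd 2 j)), Literature.Probability.LatticeModels.latticeApprox δ (x (Fin.natAdd 2 j))]) q4 (nhdsWithin 0 (Set.Ioi 0)) (Literature.Probability.LatticeModels.NonCoincident 3 (2 + 2)) → ContinuousOn q4 (Literature.Probability.LatticeModels.NonCoincident 3 (2 + 2)) → (∀ (v : EuclideanSpace ℝ (Fin 3)), ∀ x ∈ Literature.Probability.LatticeModels.NonCoincident 3 (2 + 2), q4 (fun i => x i + v) = q4 x) → ∃ (Δ : ℝ) (ψ : EuclideanSpace ℝ (Fin 3) → ℝ), ContinuousOn ψ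 {0}ᶜ ∧ (∀ u : EuclideanSpace ℝ (Fin 3), u ≠ 0 → 0 < ψ u) ∧ (∀ c : ℝ, 0 < c → ∀ u : EuclideanSpace ℝ (Fin 3), u ≠ 0 → ψ (c • u) = c ^ (-(2 * Δ)) * ψ u) ∧ TendstoLocallyUniformlyOn (fun (δ : ℝ) (x : Fin 2 → EuclideanSpace ℝ (Fin 3)) => Literature.Probability.LatticeModels.criticalCorr 3 2 (fun i => Literature.Probability.LatticeModels.latticeApprox δ (x i)) / Literature.Probability.LatticeModels.criticalCorr 3 2 ![(0 : Literature.Probability.LatticeModels.Site 3), Pi.single (0 : Fin 3) (⌊1 / δ⌋ : ℤ)]) (fun x => ψ (x 1 - x 0)) (nhdsWithin 0 (Set.Ioi 0)) (Literature.Probability.LatticeModels.NonCoincident 3 2)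

/-- Statement of `stub_scalingLimitOfRatioLimit` (provable now). -/
def Sig.stub_scalingLimitOfRatioLimit : Prop :=
  ∀ (q : Literature.Probability.LatticeModels.CorrFamily 3) (Δ : ℝ) (ψ : EuclideanSpace ℝ (Fin 3) → ℝ), (∀ m : ℕ, TendstoLocallyUniformlyOn (fun (δ : ℝ) (x : Fin (m + m) → EuclideanSpace ℝ (Fin 3)) => Literature.Probability.LatticeModels.criticalCorr 3 (m + m) (fun i => Literature.Probability.LatticeModels.latticeApprox δ (x i)) / ∏ j : Fin m, Literature.Probability.LatticeModels.criticalCorr 3 2 ![Literature.Probability.LatticeModels.latticeApprox δ (x (Fin.castAdd m j)), Literature.Probability.LatticeModels.latticeApprox δ (x (Fin.natAdd m j))]) (q (m + m)) (nhdsWithin 0 (Set.Ioi 0)) (Literature.Probability.LatticeModels.NonCoincident 3 (m + m))) → (∀ m : ℕ, ContinuousOn (q (m + m)) (Literature.Probability.LatticeModels.NonCoincident 3 (m + m))) → (∀ (m : ℕ) (v : EuclideanSpace ℝ (Fin 3)), ∀ x ∈ Literature.Probability.LatticeModels.NonCoincident 3 (m + m), q (m + m) (fun i => x i + v) = q (m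 + m) x) → (∀ (m : ℕ) (c : ℝ), 0 < c → ∀ x ∈ Literature.Probability.LatticeModels.NonCoincident 3 (m + m), q (m + m) (fun i => c • x i) = q (m + m) x) → ContinuousOn ψ {0}ᶜ → (∀ u : EuclideanSpace ℝ (Fin 3), u ≠ 0 → 0 < ψ u) → (∀ c : ℝ, 0 < c → ∀ u : EuclideanSpace ℝ (Fin 3), u ≠ 0 → ψ (c • u) = c ^ (-(2 * Δ)) * ψ u) → TendstoLocallyUniformlyOn (fun (δ : ℝ) (x : Fin 2 → EuclideanSpace ℝ (Fin 3)) => Literature.Probability.LatticeModels.criticalCorr 3 2 (fun i => Literature.Probability.LatticeModels.latticeApprox δ (x i)) / Literature.Probability.LatticeModels.criticalCorr 3 2 ![(0 : Literature.Probability.LatticeModels.Site 3), Pi.single (0 : Fin 3) (⌊1 / δ⌋ : ℤ)]) (fun x => ψ (x 1 - x 0)) (nhdsWithin 0 (Set.Ioi 0)) (Literature.Probability.LatticeModels.NonCoincident 3 2) → ∃ (ρ : ℝ → ℝ) (S : Literature.Probability.LatticeModels.CorrFamily 3), (∀ δ ∈ Set.Ioc (0 : ℝ) 1, 0 < ρ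 δ) ∧ Literature.Probability.LatticeModels.HasPointwiseScalingLimit (Literature.Probability.LatticeModels.criticalCorr 3) ρ S ∧ (∀ (n : ℕ) (z : Fin n → EuclideanSpace ℝ (Fin 3)), z ∉ Literature.Probability.LatticeModels.NonCoincident 3 n → S n z = 0) ∧ Literature.Probability.LatticeModels.IsNondegenerateTwoPoint S ∧ Literature.Probability.LatticeModels.IsTranslationInvariant S ∧ Literature.Probability.LatticeModels.IsScaleCovariant Δ S ∧ (∀ m : ℕ, ∀ x ∈ Literature.Probability.LatticeModels.NonCoincident 3 (m + m), S (m + m) x = q (m + m) x * ∏ j : Fin m, ψ (x (Fin.natAdd m j) - x (Fin.castAdd m j)))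

/-- Birth-skeleton statement `stub_ratioTranslation` (no longer a stub: a COROLLARY of `stub_ratioLimitExists`). -/
def Sig.stub_ratioTranslation : Prop :=
  ∀ (m : ℕ) (v : EuclideanSpace ℝ (Fin 3)), ∀ x ∈ Literature.Probability.LatticeModels.NonCoincident 3 (m + m), Filter.Tendsto (fun δ : ℝ => Literature.Probability.LatticeModels.criticalCorr 3 (m + m) (fun i => Literature.Probability.LatticeModels.latticeApprox δ (x i + v)) / (∏ j : Fin m, Literature.Probability.LatticeModels.criticalCorr 3 2 ![Literature.Probability.LatticeModels.latticeApprox δ (x (Fin.castAdd m j) + v), Literature.Probability.LatticeModels.latticeApprox δ (x (Fin.natAdd m j) + v)]) - Literature.Probability.LatticeModels.criticalCorr 3 (m + m) (fun i => Literature.Probability.LatticeModels.latticeApprox δ (x i)) / (∏ j : Fin m, Literature.Probability.LatticeModels.criticalCorr 3 2 ![Literature.Probability.LatticeModels.latticeApprox δ (x (Fin.castAdd m j)), Literature.Probability.LatticeModels.latticeApprox δ (x (Fin.natAdd m j))])) (nhdsWithin 0 (Set.Ioi 0)) (nhds 0)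

/-- Birth-skeleton statement `stub_ratioRotation` (no longer a stub: a COROLLARY of `stub_ratioLimitExists`). -/
def Sig.stub_ratioRotation : Prop :=
  ∀ (m : ℕ) (A : EuclideanSpace ℝ (Fin 3) ≃ₗᵢ[ℝ] EuclideanSpace ℝ (Fin 3)), ∀ x ∈ Literature.Probability.LatticeModels.NonCoincident 3 (m + m), Filter.Tendsto (fun δ : ℝ => Literature.Probability.LatticeModels.criticalCorr 3 (m + m) (fun i => Literature.Probability.LatticeModels.latticeApprox δ (A (x i))) / (∏ j : Fin m, Literature.Probability.LatticeModels.criticalCorr 3 2 ![Literature.Probability.LatticeModels.latticeApprox δ (A (x (Fin.castAdd m j))), Literature.Probability.LatticeModels.latticeApprox δ (A (x (Fin.natAdd m j)))]) - Literature.Probability.LatticeModels.criticalCorr 3 (m + m) (fun i => Literature.Probability.LatticeModels.latticeApprox δ (x i)) / (∏ j : Fin m, Literature.Probability.LatticeModels.criticalCorr 3 2 ![Literature.Probability.LatticeModels.latticeApprox δ (x (Fin.castAdd m j)), Literature.Probability.LatticeModels.latticeApprox δ (x (Fin.natAdd m j))])) (nhdsWithin 0 (Set.Ioi 0)) (nhds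 0)

/-! ## §2 Registered stubs (the ONLY `sorry`s of this file) -/

/-- **Stub 1 (CONVERGENCE of the pairing ratios; OPEN, XL).** Some family `q : CorrFamily 3` is, for every `m`,
the locally uniform limit as `δ → 0⁺` of `pairingRatio m δ ·` on `NonCoincident 3 (m+m)` (only the values
`q (m+m)` on the locus matter).  Existence of critical scaling limits on `ℤ³` (DuminilCopinICM2022 §8.4 p.29); for
`m ≥ 2` the uniqueness of subsequential limits of 4-point pairing ratios.  Wave-1 verdict: blocked on open item
4841 `CurrentConnectionInvariance.RatioLimit` (continuous positive limits of the telescoping ratios imply it by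
`Q_{m+1} = Q_m / R_{2m} ∘ perm`), alternatively 5355 `PrimaryAtInfinity.ExistsRegularLimit`. -/
theorem stub_ratioLimitExists :
    ∃ q : Literature.Probability.LatticeModels.CorrFamily 3, ∀ m : ℕ, TendstoLocallyUniformlyOn (fun (δ : ℝ) (x : Fin (m + m) → EuclideanSpace ℝ (Fin 3)) => Literature.Probability.LatticeModels.criticalCorr 3 (m + m) (fun i => Literature.Probability.LatticeModels.latticeApprox δ (x i)) / ∏ j : Fin m, Literature.Probability.LatticeModels.criticalCorr 3 2 ![Literature.Probability.LatticeModels.latticeApprox δ (x (Fin.castAdd m j)), Literature.Probability.LatticeModels.latticeApprox δ (x (Fin.natAdd m j))]) (q (m + m)) (nhdsWithin 0 (Set.Ioi 0)) (Literature.Probability.LatticeModels.NonCoincident 3 (m + m)) := by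
  sorry

/-- **Stub 2 (asymptotic UNIT-INVERSION invariance on the lattice — the Cardy-type target; OPEN, XL).** For
`x` non-coincident with every `x_i ≠ 0`, `pairingRatio m δ (ι∘x) − pairingRatio m δ x → 0` as `δ → 0⁺`,
`ι = EuclideanGeometry.inversion 0 1`.  Conformal invariance proper of 3D Ising pairing probabilities
(DuminilCopinICM2022 §8.4 p.29 "widely open"); the model-blind upgrade Euclid + scale ⇒ inversion is refuted
(`Literature.Barriers.CriticalPhenomena.ScaleCovarianceNotMoebius`), and the tree's Ising-specific upgrade
`HyperoctahedralRP.InversionUpgradeNormalised` (item 1982) is open. -/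
theorem stub_ratioInversion :
    ∀ (m : ℕ), ∀ x ∈ Literature.Probability.LatticeModels.NonCoincident 3 (m + m), (∀ i, x i ≠ 0) → Filter.Tendsto (fun δ : ℝ => Literature.Probability.LatticeModels.criticalCorr 3 (m + m) (fun i => Literature.Probability.LatticeModels.latticeApprox δ (EuclideanGeometry.inversion 0 1 (x i))) / (∏ j : Fin m, Literature.Probability.LatticeModels.criticalCorr 3 2 ![Literature.Probability.LatticeModels.latticeApprox δ (EuclideanGeometry.inversion 0 1 (x (Fin.castAdd m j))), Literature.Probability.LatticeModels.latticeApprox δ (EuclideanGeometry.inversion 0 1 (x (Fin.natAdd m j)))]) - Literature.Probability.LatticeModels.criticalCorr 3 (m + m) (fun i => Literature.Probability.LatticeModels.latticeApprox δ (x i)) / (∏ j : Fin m, Literature.Probability.LatticeModels.criticalCorr 3 2 ![Literature.Probability.LatticeModels.latticeApprox δ (x (Fin.castAdd m j)), Literature.Probability.LatticeModels.latticeApprox δ (x (Fin.natAdd m j))])) (nhdsWithin 0 (Set.Ioi 0)) (nhds 0) := by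
  sorry

-- Stubs 3 and 4 (`stub_cellLimitTranslate`, `stub_cellLimitContinuous`) are LANDED (p148702, p151155) and imported:
-- `Theorems/LinkingParityCirclesSpinRatioMoebiusStubCellLimitTranslate.lean`, `…StubCellLimitContinuous.lean`.

-- Stubs 5 and 6 (`stub_twoPointOfRatioLimit`, `stub_scalingLimitOfRatioLimit`) are LANDED (p152013, p151899) and imported:
-- `Theorems/LinkingParityCirclesSpinRatioMoebiusStubTwoPointOfRatioLimit.lean` (+ helpers `…TwoPointPrelim.lean`,
-- `…TwoPointConfigs.lean`), `Theorems/LinkingParityCirclesSpinRatioMoebiusStubScalingLimitOfRatioLimit.lean`.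

/-! ## §2b Registered stubs of reshape 2 — ALL FOUR LANDED (wave 2 of the continuation lead) and imported

* Stub 7 `stub_prodPairsLe` (iterated GKS II, `∏_j ⟨σ_{y_j}σ_{y_{j+m}}⟩ ≤ ⟨∏σ_{yᵢ}⟩` at injective `y`): p155354,
  `Theorems/LinkingParityCirclesSpinRatioMoebiusStubProdPairsLe.lean`;
* Stub 8 `stub_ratioLimitOfScalingLimit` (ratio limits from ANY non-degenerate pointwise scaling limit, explicit limit
  `S_{2m}/∏_j S_2(pairs)`): p155374, `Theorems/LinkingParityCirclesSpinRatioMoebiusStubRatioLimitOfScalingLimit.lean`;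
* Stub 9 `stub_ratioInversionOfCCI` (`stub_ratioInversion` from Stub 7, `stub_ratioLimitExists` and item 4840): p155919,
  `Theorems/LinkingParityCirclesSpinRatioMoebiusStubRatioInversionOfCCI.lean`;
* Stub 10 `stub_ratioOfCovariantFamily` (pairing quotients of a Möbius covariant family are Möbius invariant): p155409,
  `Theorems/LinkingParityCirclesSpinRatioMoebiusStubRatioOfCovariantFamily.lean`.
Their signatures are kept verbatim as `Sig.stub_…` in §9, where the compositions consume them. -/

/-! ## §3 The stubs read through `pairingRatio` (kernel-checked identities) -/

theorem sig_ratioLimitExists_iff :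
    Sig.stub_ratioLimitExists ↔ ∃ q : CorrFamily 3, ∀ m : ℕ,
      TendstoLocallyUniformlyOn (pairingRatio m) (q (m + m)) (𝓝[>] (0 : ℝ)) (NonCoincident 3 (m + m)) :=
  Iff.rfl

theorem sig_ratioTranslation_iff :
    Sig.stub_ratioTranslation ↔ ∀ (m : ℕ) (v : EuclideanSpace ℝ (Fin 3)), ∀ x ∈ NonCoincident 3 (m + m),
      Tendsto (fun δ : ℝ => pairingRatio m δ (fun i => x i + v) - pairingRatio m δ x) (𝓝[>] (0 : ℝ)) (𝓝 0) :=
  Iff.rfl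

theorem sig_ratioRotation_iff :
    Sig.stub_ratioRotation ↔ ∀ (m : ℕ) (A : EuclideanSpace ℝ (Fin 3) ≃ₗᵢ[ℝ] EuclideanSpace ℝ (Fin 3)),
      ∀ x ∈ NonCoincident 3 (m + m),
      Tendsto (fun δ : ℝ => pairingRatio m δ (fun i => A (x i)) - pairingRatio m δ x) (𝓝[>] (0 : ℝ)) (𝓝 0) :=
  Iff.rfl

theorem sig_ratioInversion_iff :
    Sig.stub_ratioInversion ↔ ∀ (m : ℕ), ∀ x ∈ NonCoincident 3 (m + m), (∀ i, x i ≠ 0) →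
      Tendsto (fun δ : ℝ => pairingRatio m δ (fun i => EuclideanGeometry.inversion 0 1 (x i)) - pairingRatio m δ x)
        (𝓝[>] (0 : ℝ)) (𝓝 0) :=
  Iff.rfl

/-! ## §4 Sorry-free glue, I: normalisation, exact lattice identities, limit uniqueness -/

open scoped Classical in
/-- The normalised family: the ratio limit at even levels on non-coincident configurations, `0` elsewhere
(odd levels, coincident configurations), where the crux's convergence clause says nothing. -/
def normalise (q : CorrFamily 3) : CorrFamily 3 := fun n x =>
  if Even n ∧ x ∈ NonCoincident 3 n then q n x else 0

theorem normalise_of_pos {q : CorrFamily 3} {n : ℕ} {x : Fin n → EuclideanSpace ℝ (Fin 3)}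
    (hn : Even n) (hx : x ∈ NonCoincident 3 n) : normalise q n x = q n x := by
  unfold normalise
  rw [if_pos ⟨hn, hx⟩]

theorem normalise_of_neg {q : CorrFamily 3} {n : ℕ} {x : Fin n → EuclideanSpace ℝ (Fin 3)}
    (h : ¬ (Even n ∧ x ∈ NonCoincident 3 n)) : normalise q n x = 0 := by
  unfold normalise
  rw [if_neg h]

/-- Injective maps of `ℝ³` preserve and reflect non-coincidence of configurations. -/
theorem comp_mem_nonCoincident_iff {n : ℕ} {φ : EuclideanSpace ℝ (Fin 3) → EuclideanSpace ℝ (Fin 3)}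
    (hφ : Function.Injective φ) (x : Fin n → EuclideanSpace ℝ (Fin 3)) :
    (fun i => φ (x i)) ∈ NonCoincident 3 n ↔ x ∈ NonCoincident 3 n := by
  simp only [mem_nonCoincident]
  exact ⟨fun h => Function.Injective.of_comp (f := φ) h, fun h => hφ.comp h⟩

/-- Hence the pairing ratio of the dilated configuration at mesh `δ` IS the pairing ratio at mesh `δ / c`. -/
theorem pairingRatio_smul (m : ℕ) (δ c : ℝ) (x : Fin (m + m) → EuclideanSpace ℝ (Fin 3)) :
    pairingRatio m δ (fun i => c • x i) = pairingRatio m (δ / c) x := by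
  simp only [pairingRatio, Theorems.MoebiusLimitOfTwoPointLaw.Negative.latticeApprox_smul]

/-- Hence the pairing ratio is invariant under the common lattice translations `xᵢ ↦ xᵢ + δ • k`
(translation invariance of `⟨·⟩⁺_{β_c}`, `criticalCorr_translate`). -/
theorem pairingRatio_shift {δ : ℝ} (hδ : 0 < δ) (m : ℕ) (x : Fin (m + m) → EuclideanSpace ℝ (Fin 3))
    (k : Site 3) : pairingRatio m δ (fun i => x i + δ • siteVec k) = pairingRatio m δ x := by
  unfold pairingRatio
  simp only [latticeApprox_add_mesh_smul' hδ]
  rw [criticalCorr_translate]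
  congr 1
  refine Finset.prod_congr rfl fun j _ => ?_
  have h : (![latticeApprox δ (x (Fin.castAdd m j)) + k, latticeApprox δ (x (Fin.natAdd m j)) + k] :
      Fin 2 → Site 3) =
      fun i => ![latticeApprox δ (x (Fin.castAdd m j)), latticeApprox δ (x (Fin.natAdd m j))] i + k := by
    funext i; fin_cases i <;> rfl
  rw [h, criticalCorr_translate]

/-- The pairing ratio is a CELL functional: it depends on `x` only through the cells `⌊x i j / δ⌋`. -/
theorem pairingRatio_cell (m : ℕ) (δ : ℝ) {x y : Fin (m + m) → EuclideanSpace ℝ (Fin 3)}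
    (h : ∀ i j, ⌊x i j / δ⌋ = ⌊y i j / δ⌋) : pairingRatio m δ x = pairingRatio m δ y := by
  have hL : ∀ i, latticeApprox δ (x i) = latticeApprox δ (y i) := fun i => funext fun j => by
    rw [latticeApprox_apply, latticeApprox_apply, h i j]
  unfold pairingRatio
  simp only [hL]

/-- At level `m = 1` the pairing ratio is identically `1` (`⟨σ_aσ_b⟩/⟨σ_aσ_b⟩`, the pair value being `> 0`). -/
theorem pairingRatio_one (δ : ℝ) (x : Fin (1 + 1) → EuclideanSpace ℝ (Fin 3)) : pairingRatio 1 δ x = 1 := by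
  unfold pairingRatio
  rw [Fin.prod_univ_one]
  have h : (fun i => latticeApprox δ (x i)) =
      ![latticeApprox δ (x (Fin.castAdd 1 0)), latticeApprox δ (x (Fin.natAdd 1 0))] := by
    funext i; fin_cases i <;> rfl
  rw [h]
  exact div_self (Cruxes.IsingEuclidUpgradeR4NonGaussian.FreeCovarianceDeltaDichotomy.criticalCorr_two_pos' _ _).ne'

/-- Limits along the mesh filter of asymptotically equal quantities are equal. -/
theorem eq_of_tendsto_sub {F G : ℝ → ℝ} {a b : ℝ}
    (hF : Tendsto F (𝓝[>] (0 : ℝ)) (𝓝 a)) (hG : Tendsto G (𝓝[>] (0 : ℝ)) (𝓝 b))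
    (h : Tendsto (fun δ => F δ - G δ) (𝓝[>] (0 : ℝ)) (𝓝 0)) : a = b := by
  have h' : Tendsto (fun δ => F δ - G δ) (𝓝[>] (0 : ℝ)) (𝓝 (a - b)) := hF.sub hG
  have hab : a - b = 0 := tendsto_nhds_unique h' h
  linarith

/-- SYMMETRY TRANSFER: a locally uniform ratio limit `g` takes equal values at two non-coincident configurations
whose lattice ratios are asymptotically equal along the mesh filter. -/
theorem limit_eq_of_asymptotic {m : ℕ} {g : (Fin (m + m) → EuclideanSpace ℝ (Fin 3)) → ℝ}
    (hg : TendstoLocallyUniformlyOn (pairingRatio m) g (𝓝[>] (0 : ℝ)) (NonCoincident 3 (m + m)))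
    {x y : Fin (m + m) → EuclideanSpace ℝ (Fin 3)} (hx : x ∈ NonCoincident 3 (m + m))
    (hy : y ∈ NonCoincident 3 (m + m))
    (h : Tendsto (fun δ : ℝ => pairingRatio m δ y - pairingRatio m δ x) (𝓝[>] (0 : ℝ)) (𝓝 0)) :
    g y = g x :=
  eq_of_tendsto_sub (hg.tendsto_at hy) (hg.tendsto_at hx) h

/-- Conversely, equal limit values give asymptotically equal lattice ratios. -/
theorem asymptotic_of_limit_eq {m : ℕ} {g : (Fin (m + m) → EuclideanSpace ℝ (Fin 3)) → ℝ}
    (hg : TendstoLocallyUniformlyOn (pairingRatio m) g (𝓝[>] (0 : ℝ)) (NonCoincident 3 (m + m)))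
    {x y : Fin (m + m) → EuclideanSpace ℝ (Fin 3)} (hx : x ∈ NonCoincident 3 (m + m))
    (hy : y ∈ NonCoincident 3 (m + m)) (h : g y = g x) :
    Tendsto (fun δ : ℝ => pairingRatio m δ y - pairingRatio m δ x) (𝓝[>] (0 : ℝ)) (𝓝 0) := by
  have h' := (hg.tendsto_at hy).sub (hg.tendsto_at hx)
  rw [h, sub_self] at h'
  exact h'

/-- DILATION INVARIANCE IS FREE: a locally uniform ratio limit is invariant under `x ↦ c • x`, `c > 0`
(exact identity `pairingRatio_smul` + the mesh filter is dilation invariant). -/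
theorem limit_smul_eq {m : ℕ} {g : (Fin (m + m) → EuclideanSpace ℝ (Fin 3)) → ℝ}
    (hg : TendstoLocallyUniformlyOn (pairingRatio m) g (𝓝[>] (0 : ℝ)) (NonCoincident 3 (m + m)))
    {c : ℝ} (hc : 0 < c) {x : Fin (m + m) → EuclideanSpace ℝ (Fin 3)} (hx : x ∈ NonCoincident 3 (m + m))
    (hcx : (fun i => c • x i) ∈ NonCoincident 3 (m + m)) :
    g (fun i => c • x i) = g x := by
  have h1 : Tendsto (fun δ : ℝ => pairingRatio m δ (fun i => c • x i)) (𝓝[>] (0 : ℝ)) (𝓝 (g (fun i => c • x i))) :=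
    hg.tendsto_at hcx
  have h2 : Tendsto (fun δ : ℝ => pairingRatio m (δ / c) x) (𝓝[>] (0 : ℝ)) (𝓝 (g x)) :=
    (hg.tendsto_at hx).comp (tendsto_div_const_nhdsGT hc)
  have h3 : (fun δ : ℝ => pairingRatio m δ (fun i => c • x i)) = fun δ : ℝ => pairingRatio m (δ / c) x :=
    funext fun δ => pairingRatio_smul m δ c x
  rw [h3] at h1
  exact tendsto_nhds_unique h1 h2

/-! ## §5 Sorry-free glue, II: the free symmetries of ratio limits (translation, continuity, level 2, rotation) -/

section FreeSymmetries

variable {q : CorrFamily 3}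

/-- TRANSLATION INVARIANCE IS FREE (Stub 3 applied to the lattice-shift invariant cell functional `pairingRatio m`). -/
theorem ratioLimit_translate (hT : Sig.stub_cellLimitTranslate) {m : ℕ}
    (hq : TendstoLocallyUniformlyOn (pairingRatio m) (q (m + m)) (𝓝[>] (0 : ℝ)) (NonCoincident 3 (m + m)))
    (v : EuclideanSpace ℝ (Fin 3)) {x : Fin (m + m) → EuclideanSpace ℝ (Fin 3)}
    (hx : x ∈ NonCoincident 3 (m + m)) : q (m + m) (fun i => x i + v) = q (m + m) x :=
  hT (m + m) (pairingRatio m) (q (m + m)) (fun _ hδ x k => pairingRatio_shift hδ m x k) hq v x hx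

/-- CONTINUITY IS FREE (Stub 4 applied to `pairingRatio m`, translation invariance from Stub 3). -/
theorem ratioLimit_continuousOn (hT : Sig.stub_cellLimitTranslate) (hC : Sig.stub_cellLimitContinuous) {m : ℕ}
    (hq : TendstoLocallyUniformlyOn (pairingRatio m) (q (m + m)) (𝓝[>] (0 : ℝ)) (NonCoincident 3 (m + m))) :
    ContinuousOn (q (m + m)) (NonCoincident 3 (m + m)) :=
  hC (m + m) (pairingRatio m) (q (m + m)) (fun δ _ _ _ h => pairingRatio_cell m δ h)
    (fun v _ hx => ratioLimit_translate hT hq v hx) hq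

/-- DILATION INVARIANCE in the form consumed by Stub 6. -/
theorem ratioLimit_smul {m : ℕ}
    (hq : TendstoLocallyUniformlyOn (pairingRatio m) (q (m + m)) (𝓝[>] (0 : ℝ)) (NonCoincident 3 (m + m)))
    (c : ℝ) (hc : 0 < c) {x : Fin (m + m) → EuclideanSpace ℝ (Fin 3)} (hx : x ∈ NonCoincident 3 (m + m)) :
    q (m + m) (fun i => c • x i) = q (m + m) x :=
  limit_smul_eq hq hc hx ((comp_mem_nonCoincident_iff (smul_right_injective _ hc.ne') x).2 hx)

/-- At level `2 = 1 + 1` every ratio limit is `1` on the locus (`pairingRatio_one`). -/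
theorem ratioLimit_two (hq : TendstoLocallyUniformlyOn (pairingRatio 1) (q (1 + 1)) (𝓝[>] (0 : ℝ)) (NonCoincident 3 (1 + 1)))
    {x : Fin (1 + 1) → EuclideanSpace ℝ (Fin 3)} (hx : x ∈ NonCoincident 3 (1 + 1)) : q (1 + 1) x = 1 := by
  have h1 : Tendsto (fun δ : ℝ => pairingRatio 1 δ x) (𝓝[>] (0 : ℝ)) (𝓝 (q (1 + 1) x)) := hq.tendsto_at hx
  have h2 : Tendsto (fun δ : ℝ => pairingRatio 1 δ x) (𝓝[>] (0 : ℝ)) (𝓝 1) := by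
    simp only [pairingRatio_one]
    exact tendsto_const_nhds
  exact tendsto_nhds_unique h1 h2

/-- A pair `![a, b]` with `a ≠ b` is a non-coincident configuration of `1 + 1` points. -/
theorem pair_mem_nonCoincident' {a b : EuclideanSpace ℝ (Fin 3)} (h : a ≠ b) :
    (![a, b] : Fin (1 + 1) → EuclideanSpace ℝ (Fin 3)) ∈ NonCoincident 3 (1 + 1) := by
  rw [mem_nonCoincident]
  intro i j hij
  fin_cases i <;> fin_cases j
  · rfl
  · exact absurd hij h
  · exact absurd hij.symm h
  · rfl

/-- THE PINNED LIMIT: from ratio limits at every level, Stubs 3–6 build the pinned two-point limit `ψ` and the pinned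
scaling limit `S` (`S_{2m} = q_{2m} ∏ ψ`), which the landed `HyperoctahedralRP` theorems (`HRP2Rigidity_of`,
`limitRotationInvariant_proof`) make `O(3)` invariant. -/
theorem exists_pinnedLimit (hT : Sig.stub_cellLimitTranslate) (hC : Sig.stub_cellLimitContinuous)
    (h5 : Sig.stub_twoPointOfRatioLimit) (h6 : Sig.stub_scalingLimitOfRatioLimit)
    (hq : ∀ m : ℕ, TendstoLocallyUniformlyOn (pairingRatio m) (q (m + m)) (𝓝[>] (0 : ℝ)) (NonCoincident 3 (m + m))) :
    ∃ (ρ : ℝ → ℝ) (Δ : ℝ) (ψ : EuclideanSpace ℝ (Fin 3) → ℝ) (S : CorrFamily 3),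
      (∀ δ ∈ Set.Ioc (0 : ℝ) 1, 0 < ρ δ) ∧ HasPointwiseScalingLimit (criticalCorr 3) ρ S ∧
      (∀ (n : ℕ) (z : Fin n → EuclideanSpace ℝ (Fin 3)), z ∉ NonCoincident 3 n → S n z = 0) ∧
      IsNondegenerateTwoPoint S ∧ IsTranslationInvariant S ∧ IsScaleCovariant Δ S ∧ IsRotationInvariant S ∧
      (∀ u : EuclideanSpace ℝ (Fin 3), u ≠ 0 → 0 < ψ u) ∧
      (∀ m : ℕ, ∀ x ∈ NonCoincident 3 (m + m), S (m + m) x = q (m + m) x * ∏ j : Fin m, ψ (x (Fin.natAdd m j) - x (Fin.castAdd m j))) ∧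
      (∀ a b : EuclideanSpace ℝ (Fin 3), a ≠ b → S 2 ![a, b] = ψ (b - a)) := by
  -- the free inputs
  have hcont : ∀ m : ℕ, ContinuousOn (q (m + m)) (NonCoincident 3 (m + m)) :=
    fun m => ratioLimit_continuousOn hT hC (hq m)
  have htrans : ∀ (m : ℕ) (v : EuclideanSpace ℝ (Fin 3)), ∀ x ∈ NonCoincident 3 (m + m),
      q (m + m) (fun i => x i + v) = q (m + m) x := fun m v x hx => ratioLimit_translate hT (hq m) v hx
  have hdil : ∀ (m : ℕ) (c : ℝ), 0 < c → ∀ x ∈ NonCoincident 3 (m + m),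
      q (m + m) (fun i => c • x i) = q (m + m) x := fun m c hc x hx => ratioLimit_smul (hq m) c hc hx
  -- the pinned two-point limit and the pinned scaling limit
  obtain ⟨Δ, ψ, hψc, hψpos, hψhom, h2pt⟩ := h5 (q (2 + 2)) (hq 2) (hcont 2) (htrans 2)
  obtain ⟨ρ, S, hρ, hS, hnorm, hnd, htr, hsc, hform⟩ :=
    h6 q Δ ψ hq hcont htrans hdil hψc hψpos hψhom h2pt
  -- every such limit is `O(3)` invariant (route HyperoctahedralRP, items 1979/1980/8367, landed)
  have hrot : IsRotationInvariant S :=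
    Cruxes.LimitRotationInvariant.QuarterTurnLiouville.limitRotationInvariant_proof
      Cruxes.HRP2Rigidity.XRayMellin.HRP2Rigidity_of ρ Δ S hρ hS hnorm hnd htr hsc
  refine ⟨ρ, Δ, ψ, S, hρ, hS, hnorm, hnd, htr, hsc, hrot, hψpos, hform, ?_⟩
  -- `S 2 (a, b) = ψ (b - a)`
  intro a b hab
  have hc : (![a, b] : Fin (1 + 1) → EuclideanSpace ℝ (Fin 3)) ∈ NonCoincident 3 (1 + 1) := pair_mem_nonCoincident' hab
  have h1 := hform 1 _ hc
  rw [ratioLimit_two (hq 1) hc] at h1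
  have e3 : (![a, b] : Fin (1 + 1) → EuclideanSpace ℝ (Fin 3)) (Fin.natAdd 1 (0 : Fin 1)) = b := rfl
  have e4 : (![a, b] : Fin (1 + 1) → EuclideanSpace ℝ (Fin 3)) (Fin.castAdd 1 (0 : Fin 1)) = a := rfl
  simp only [Fin.prod_univ_one, one_mul, e3, e4] at h1
  exact h1

/-- The product of the paired norms is the product of all norms (the pairing covers every index once). -/
theorem prod_pair_norms (m : ℕ) (Δ : ℝ) (x : Fin (m + m) → EuclideanSpace ℝ (Fin 3)) :
    (∏ j : Fin m, ‖x (Fin.castAdd m j)‖ ^ (2 * Δ) * ‖x (Fin.natAdd m j)‖ ^ (2 * Δ)) =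
      ∏ i : Fin (m + m), ‖x i‖ ^ (2 * Δ) := by
  rw [Fin.prod_univ_add, Finset.prod_mul_distrib]

/-- `O(3)` INVARIANCE IS FREE: given ratio limits at every level, every `q (m+m)` is invariant under all linear
isometries on the locus (`q_{2m} = S_{2m}/∏ S_2` for the `O(3)`-invariant pinned limit `S`). -/
theorem ratioLimit_rotate (hT : Sig.stub_cellLimitTranslate) (hC : Sig.stub_cellLimitContinuous)
    (h5 : Sig.stub_twoPointOfRatioLimit) (h6 : Sig.stub_scalingLimitOfRatioLimit)
    (hq : ∀ m : ℕ, TendstoLocallyUniformlyOn (pairingRatio m) (q (m + m)) (𝓝[>] (0 : ℝ)) (NonCoincident 3 (m + m)))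
    (m : ℕ) (A : EuclideanSpace ℝ (Fin 3) ≃ₗᵢ[ℝ] EuclideanSpace ℝ (Fin 3))
    {x : Fin (m + m) → EuclideanSpace ℝ (Fin 3)} (hx : x ∈ NonCoincident 3 (m + m)) :
    q (m + m) (fun i => A (x i)) = q (m + m) x := by
  obtain ⟨ρ, Δ, ψ, S, -, -, -, -, -, -, hrot, hψpos, hform, hS2⟩ := exists_pinnedLimit hT hC h5 h6 hq
  -- the two-point kernel `ψ` is rotation invariant
  have hψrot : ∀ w : EuclideanSpace ℝ (Fin 3), w ≠ 0 → ψ (A w) = ψ w := by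
    intro w hw
    have h1 := hS2 0 w (Ne.symm hw)
    have h2 := hS2 (A 0) (A w) (fun h => hw (A.injective h).symm)
    have hcfg : (![A 0, A w] : Fin 2 → EuclideanSpace ℝ (Fin 3)) = fun i => A ((![0, w] : Fin 2 → EuclideanSpace ℝ (Fin 3)) i) := by
      funext i; fin_cases i <;> rfl
    rw [hcfg, hrot 2 A, h1, map_zero, sub_zero, sub_zero] at h2
    exact h2.symm
  -- compare the normal forms of `S (m+m)` at `x` and `A ∘ x`
  have hAx : (fun i => A (x i)) ∈ NonCoincident 3 (m + m) := (comp_mem_nonCoincident_iff A.injective x).2 hx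
  have h1 := hform m x hx
  have h2 := hform m _ hAx
  rw [hrot (m + m) A x, h1] at h2
  have hprod : (∏ j : Fin m, ψ ((fun i => A (x i)) (Fin.natAdd m j) - (fun i => A (x i)) (Fin.castAdd m j))) =
      ∏ j : Fin m, ψ (x (Fin.natAdd m j) - x (Fin.castAdd m j)) := by
    refine Finset.prod_congr rfl fun j _ => ?_
    show ψ (A (x (Fin.natAdd m j)) - A (x (Fin.castAdd m j))) = _
    rw [← map_sub, hψrot _ (pair_sub_ne_zero hx j)]
  rw [hprod] at h2
  have hP : (∏ j : Fin m, ψ (x (Fin.natAdd m j) - x (Fin.castAdd m j))) ≠ 0 :=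
    Finset.prod_ne_zero_iff.2 fun j _ => (hψpos _ (pair_sub_ne_zero hx j)).ne'
  exact (mul_right_cancel₀ hP h2).symm

/-- INVERSION FROM THE UPGRADE: given ratio limits at every level, the (open) crux
`HyperoctahedralRP.InversionUpgradeNormalised` (item stmt-CriticalPhenomena-1982) — every normalised non-degenerate
Euclidean-invariant scale-covariant pointwise scaling limit of the critical `ℤ³` correlators is inversion covariant —
applied to the pinned limit `S` makes every `q (m+m)` invariant under the unit inversion on the locus (the two-point
factors pick up exactly the weight `∏ ‖xᵢ‖^{2Δ}`, the pairing covering every index once). -/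
theorem ratioLimit_invert (hT : Sig.stub_cellLimitTranslate) (hC : Sig.stub_cellLimitContinuous)
    (h5 : Sig.stub_twoPointOfRatioLimit) (h6 : Sig.stub_scalingLimitOfRatioLimit)
    (hU : HyperoctahedralRP.InversionUpgradeNormalised)
    (hq : ∀ m : ℕ, TendstoLocallyUniformlyOn (pairingRatio m) (q (m + m)) (𝓝[>] (0 : ℝ)) (NonCoincident 3 (m + m)))
    (m : ℕ) {x : Fin (m + m) → EuclideanSpace ℝ (Fin 3)} (hx : x ∈ NonCoincident 3 (m + m)) (hx0 : ∀ i, x i ≠ 0) :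
    q (m + m) (fun i => EuclideanGeometry.inversion 0 1 (x i)) = q (m + m) x := by
  obtain ⟨ρ, Δ, ψ, S, hρ, hS, hnorm, hnd, htr, hsc, hrot, hψpos, hform, hS2⟩ := exists_pinnedLimit hT hC h5 h6 hq
  have hinv : IsInversionCovariant Δ S := hU ρ Δ S hρ hS hnorm hnd ⟨htr, hrot⟩ hsc
  have hι : Function.Injective (EuclideanGeometry.inversion (0 : EuclideanSpace ℝ (Fin 3)) 1) :=
    EuclideanGeometry.inversion_injective _ one_ne_zero
  -- two-point: `ψ (ι b - ι a) = ‖a‖^{2Δ} ‖b‖^{2Δ} ψ (b - a)`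
  have hψinv : ∀ a b : EuclideanSpace ℝ (Fin 3), a ≠ 0 → b ≠ 0 → a ≠ b →
      ψ (EuclideanGeometry.inversion 0 1 b - EuclideanGeometry.inversion 0 1 a) = ‖a‖ ^ (2 * Δ) * ‖b‖ ^ (2 * Δ) * ψ (b - a) := by
    intro a b ha hb hab
    have h1 := hS2 a b hab
    have h2 := hS2 _ _ (fun h => hab (hι h))
    have h3 := hinv 2 ![a, b] (fun i => by fin_cases i <;> assumption)
    have hcfg : (fun i => EuclideanGeometry.inversion 0 1 ((![a, b] : Fin 2 → EuclideanSpace ℝ (Fin 3)) i)) =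
        ![EuclideanGeometry.inversion 0 1 a, EuclideanGeometry.inversion 0 1 b] := by
      funext i; fin_cases i <;> rfl
    rw [hcfg, h2, h1, Fin.prod_univ_two] at h3
    simpa using h3
  -- level `m + m`
  have hιx : (fun i => EuclideanGeometry.inversion 0 1 (x i)) ∈ NonCoincident 3 (m + m) :=
    (comp_mem_nonCoincident_iff hι x).2 hx
  have h1 := hform m x hx
  have h2 := hform m _ hιx
  rw [hinv (m + m) x hx0, h1] at h2
  have hprod : (∏ j : Fin m, ψ ((fun i => EuclideanGeometry.inversion 0 1 (x i)) (Fin.natAdd m j) -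
      (fun i => EuclideanGeometry.inversion 0 1 (x i)) (Fin.castAdd m j))) =
      (∏ i : Fin (m + m), ‖x i‖ ^ (2 * Δ)) * ∏ j : Fin m, ψ (x (Fin.natAdd m j) - x (Fin.castAdd m j)) := by
    rw [← prod_pair_norms, ← Finset.prod_mul_distrib]
    refine Finset.prod_congr rfl fun j _ => ?_
    have hne : x (Fin.castAdd m j) ≠ x (Fin.natAdd m j) := fun h => pair_sub_ne_zero hx j (sub_eq_zero.2 h.symm)
    exact hψinv _ _ (hx0 _) (hx0 _) hne
  rw [hprod] at h2
  have hW : (∏ i : Fin (m + m), ‖x i‖ ^ (2 * Δ)) ≠ 0 :=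
    Finset.prod_ne_zero_iff.2 fun i _ => (Real.rpow_pos_of_pos (norm_pos_iff.2 (hx0 i)) _).ne'
  have hP : (∏ j : Fin m, ψ (x (Fin.natAdd m j) - x (Fin.castAdd m j))) ≠ 0 :=
    Finset.prod_ne_zero_iff.2 fun j _ => (hψpos _ (pair_sub_ne_zero hx j)).ne'
  -- `W * (q x * P) = q (ιx) * (W * P)`
  have h3 : q (m + m) x * ((∏ i : Fin (m + m), ‖x i‖ ^ (2 * Δ)) * ∏ j : Fin m, ψ (x (Fin.natAdd m j) - x (Fin.castAdd m j))) =
      q (m + m) (fun i => EuclideanGeometry.inversion 0 1 (x i)) *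
        ((∏ i : Fin (m + m), ‖x i‖ ^ (2 * Δ)) * ∏ j : Fin m, ψ (x (Fin.natAdd m j) - x (Fin.castAdd m j))) := by
    rw [← h2]
    ring
  exact (mul_right_cancel₀ (mul_ne_zero hW hP) h3).symm

end FreeSymmetries

/-! ## §6 Composition — the crux BY NAME from the six stubs (sorry-free) -/

/-- **COMPOSITION.** From a family `q` of locally uniform pairing-ratio limits (Stub 1) and the asymptotic lattice
invariance under the unit inversion (Stub 2) — translation invariance, continuity, the pinned two-point and scaling
limits being supplied by the provable Stubs 3–6, rotations by the landed `HyperoctahedralRP` rigidity, dilations by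
the exact identity `pairingRatio_smul` — the normalised family `normalise q` is Möbius covariant with weight `0` and
is still the locally uniform limit of the ratios on non-coincident configurations; this is
`Summit.CriticalPhenomena.Ising3DConformalLimit.Theses.LinkingParityCircles.SpinRatioMoebius` by name. -/
theorem SpinRatioMoebius_of :
    Sig.stub_ratioLimitExists → Sig.stub_ratioInversion → Sig.stub_cellLimitTranslate →
      Sig.stub_cellLimitContinuous → Sig.stub_twoPointOfRatioLimit → Sig.stub_scalingLimitOfRatioLimit →
      Summit.CriticalPhenomena.Ising3DConformalLimit.Theses.LinkingParityCircles.SpinRatioMoebius := by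
  intro hL hI hT hC h5 h6
  obtain ⟨q, hq⟩ := sig_ratioLimitExists_iff.1 hL
  have hI' := sig_ratioInversion_iff.1 hI
  refine ⟨normalise q, ⟨⟨?_, ?_⟩, ?_, ?_⟩, ?_⟩
  · -- translations (free)
    intro n v x
    have hφ : Function.Injective (fun y : EuclideanSpace ℝ (Fin 3) => y + v) := add_left_injective v
    by_cases h : Even n ∧ x ∈ NonCoincident 3 n
    · obtain ⟨⟨m, rfl⟩, hx⟩ := h
      have hxv : (fun i => x i + v) ∈ NonCoincident 3 (m + m) := (comp_mem_nonCoincident_iff hφ x).2 hx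
      rw [normalise_of_pos ⟨m, rfl⟩ hxv, normalise_of_pos ⟨m, rfl⟩ hx]
      exact ratioLimit_translate hT (hq m) v hx
    · have h' : ¬ (Even n ∧ (fun i => x i + v) ∈ NonCoincident 3 n) := fun hh =>
        h ⟨hh.1, (comp_mem_nonCoincident_iff hφ x).1 hh.2⟩
      rw [normalise_of_neg h', normalise_of_neg h]
  · -- linear isometries (free: HyperoctahedralRP rigidity)
    intro n A x
    by_cases h : Even n ∧ x ∈ NonCoincident 3 n
    · obtain ⟨⟨m, rfl⟩, hx⟩ := h
      have hAx : (fun i => A (x i)) ∈ NonCoincident 3 (m + m) := (comp_mem_nonCoincident_iff A.injective x).2 hx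
      rw [normalise_of_pos ⟨m, rfl⟩ hAx, normalise_of_pos ⟨m, rfl⟩ hx]
      exact ratioLimit_rotate hT hC h5 h6 hq m A hx
    · have h' : ¬ (Even n ∧ (fun i => A (x i)) ∈ NonCoincident 3 n) := fun hh =>
        h ⟨hh.1, (comp_mem_nonCoincident_iff A.injective x).1 hh.2⟩
      rw [normalise_of_neg h', normalise_of_neg h]
  · -- dilations, weight 0 (free)
    intro n c hc x
    have hc1 : c ^ (-(n : ℝ) * 0) = 1 := by
      rw [mul_zero, Real.rpow_zero]
    rw [hc1, one_mul]
    have hφ : Function.Injective (fun y : EuclideanSpace ℝ (Fin 3) => c • y) := smul_right_injective _ hc.ne'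
    by_cases h : Even n ∧ x ∈ NonCoincident 3 n
    · obtain ⟨⟨m, rfl⟩, hx⟩ := h
      have hcx : (fun i => c • x i) ∈ NonCoincident 3 (m + m) := (comp_mem_nonCoincident_iff hφ x).2 hx
      rw [normalise_of_pos ⟨m, rfl⟩ hcx, normalise_of_pos ⟨m, rfl⟩ hx]
      exact limit_smul_eq (hq m) hc hx hcx
    · have h' : ¬ (Even n ∧ (fun i => c • x i) ∈ NonCoincident 3 n) := fun hh =>
        h ⟨hh.1, (comp_mem_nonCoincident_iff hφ x).1 hh.2⟩
      rw [normalise_of_neg h', normalise_of_neg h]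
  · -- the unit inversion, weight 0 (Stub 2)
    intro n x hx0
    have hw : (∏ i : Fin n, ‖x i‖ ^ (2 * (0 : ℝ))) = 1 := by
      simp
    rw [hw, one_mul]
    have hφ : Function.Injective (EuclideanGeometry.inversion (0 : EuclideanSpace ℝ (Fin 3)) 1) :=
      EuclideanGeometry.inversion_injective _ one_ne_zero
    by_cases h : Even n ∧ x ∈ NonCoincident 3 n
    · obtain ⟨⟨m, rfl⟩, hx⟩ := h
      have hix : (fun i => EuclideanGeometry.inversion 0 1 (x i)) ∈ NonCoincident 3 (m + m) :=
        (comp_mem_nonCoincident_iff hφ x).2 hx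
      rw [normalise_of_pos ⟨m, rfl⟩ hix, normalise_of_pos ⟨m, rfl⟩ hx]
      exact limit_eq_of_asymptotic (hq m) hx hix (hI' m x hx hx0)
    · have h' : ¬ (Even n ∧ (fun i => EuclideanGeometry.inversion 0 1 (x i)) ∈ NonCoincident 3 n) := fun hh =>
        h ⟨hh.1, (comp_mem_nonCoincident_iff hφ x).1 hh.2⟩
      rw [normalise_of_neg h', normalise_of_neg h]
  · -- the convergence clause survives the normalisation (values changed only off the even non-coincident locus)
    intro m
    exact (hq m).congr_right fun x hx => (normalise_of_pos ⟨m, rfl⟩ hx).symm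

/-- The crux from the registered stubs (closed modulo exactly the two OPEN stubs `stub_ratioLimitExists`,
`stub_ratioInversion` and the four provable ones; kernel-checks that each `Sig.stub_X` IS the signature of `stub_X`). -/
theorem SpinRatioMoebius_of_stubs :
    Summit.CriticalPhenomena.Ising3DConformalLimit.Theses.LinkingParityCircles.SpinRatioMoebius :=
  SpinRatioMoebius_of stub_ratioLimitExists stub_ratioInversion stub_cellLimitTranslate stub_cellLimitContinuous
    stub_twoPointOfRatioLimit stub_scalingLimitOfRatioLimit

/-! ## §7 For the record: the birth stubs `stub_ratioTranslation`, `stub_ratioRotation` FOLLOW from convergence -/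

/-- The birth skeleton's translation stub is a consequence of the convergence stub (and the free Stub 3). -/
theorem ratioTranslation_of_ratioLimitExists (hT : Sig.stub_cellLimitTranslate) :
    Sig.stub_ratioLimitExists → Sig.stub_ratioTranslation := by
  intro hL
  obtain ⟨q, hq⟩ := sig_ratioLimitExists_iff.1 hL
  rw [sig_ratioTranslation_iff]
  intro m v x hx
  have hxv : (fun i => x i + v) ∈ NonCoincident 3 (m + m) :=
    (comp_mem_nonCoincident_iff (add_left_injective v) x).2 hx
  exact asymptotic_of_limit_eq (hq m) hx hxv (ratioLimit_translate hT (hq m) v hx)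

/-- The birth skeleton's rotation stub is a consequence of the convergence stub (and the free Stubs 3–6). -/
theorem ratioRotation_of_ratioLimitExists (hT : Sig.stub_cellLimitTranslate) (hC : Sig.stub_cellLimitContinuous)
    (h5 : Sig.stub_twoPointOfRatioLimit) (h6 : Sig.stub_scalingLimitOfRatioLimit) :
    Sig.stub_ratioLimitExists → Sig.stub_ratioRotation := by
  intro hL
  obtain ⟨q, hq⟩ := sig_ratioLimitExists_iff.1 hL
  rw [sig_ratioRotation_iff]
  intro m A x hx
  have hAx : (fun i => A (x i)) ∈ NonCoincident 3 (m + m) := (comp_mem_nonCoincident_iff A.injective x).2 hx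
  exact asymptotic_of_limit_eq (hq m) hx hAx (ratioLimit_rotate hT hC h5 h6 hq m A hx)

/-! ## §8 For the planners: the crux from TWO EXISTING OPEN ITEMS of sibling routes

With Euclidean invariance free, the remaining open content of the crux is (existence of the ratio limits) + (inversion).
The second is supplied by item stmt-CriticalPhenomena-1982 `HyperoctahedralRP.InversionUpgradeNormalised` applied to the
pinned limit; so `SpinRatioMoebius ⇐ stub_ratioLimitExists ∧ InversionUpgradeNormalised` (kernel-checked below). -/

/-- The birth skeleton's inversion stub is a consequence of the convergence stub and item 1982. -/
theorem ratioInversion_of_ratioLimitExists_of_upgrade :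
    Sig.stub_ratioLimitExists → HyperoctahedralRP.InversionUpgradeNormalised → Sig.stub_ratioInversion := by
  intro hL hU
  obtain ⟨q, hq⟩ := sig_ratioLimitExists_iff.1 hL
  rw [sig_ratioInversion_iff]
  intro m x hx hx0
  have hιx : (fun i => EuclideanGeometry.inversion 0 1 (x i)) ∈ NonCoincident 3 (m + m) :=
    (comp_mem_nonCoincident_iff (EuclideanGeometry.inversion_injective _ one_ne_zero) x).2 hx
  exact asymptotic_of_limit_eq (hq m) hx hιx
    (ratioLimit_invert stub_cellLimitTranslate stub_cellLimitContinuous stub_twoPointOfRatioLimit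
      stub_scalingLimitOfRatioLimit hU hq m hx hx0)

/-- **The crux from `stub_ratioLimitExists` and item 1982 alone** (everything else landed or free). -/
theorem SpinRatioMoebius_of_ratioLimitExists_of_inversionUpgrade :
    Sig.stub_ratioLimitExists → HyperoctahedralRP.InversionUpgradeNormalised →
      Summit.CriticalPhenomena.Ising3DConformalLimit.Theses.LinkingParityCircles.SpinRatioMoebius :=
  fun hL hU => SpinRatioMoebius_of hL (ratioInversion_of_ratioLimitExists_of_upgrade hL hU) stub_cellLimitTranslate
    stub_cellLimitContinuous stub_twoPointOfRatioLimit stub_scalingLimitOfRatioLimit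

/-- **The crux from the two OPEN items of the sibling routes alone**: item stmt-CriticalPhenomena-4841
`CurrentConnectionInvariance.RatioLimit` (⇒ `stub_ratioLimitExists`, landed bridge `ratioLimitExists_of_CCIRatioLimit`) and
item stmt-CriticalPhenomena-1982 `HyperoctahedralRP.InversionUpgradeNormalised` (⇒ `stub_ratioInversion` given the former). -/
theorem SpinRatioMoebius_of_CCIRatioLimit_of_inversionUpgrade :
    CurrentConnectionInvariance.RatioLimit → HyperoctahedralRP.InversionUpgradeNormalised →
      Summit.CriticalPhenomena.Ising3DConformalLimit.Theses.LinkingParityCircles.SpinRatioMoebius :=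
  fun hRL hU => SpinRatioMoebius_of_ratioLimitExists_of_inversionUpgrade (ratioLimitExists_of_CCIRatioLimit hRL) hU

/-! ## §9 Reshape 2 (continuation lead c1) — the pinning stubs composed (sorry-free glue)

Statements of Stubs 7–10 as named propositions, the pairing quotient of a continuum family and its packaging as a
`CorrFamily 3`, and the kernel-checked consequences:
* `SpinRatioMoebius_of_CCI` : Stub 7 → Stub 9 → `Sig.stub_ratioLimitExists` → item 4840 → crux, hence
  `SpinRatioMoebius_of_CCI_items` : Stub 7 → Stub 9 → item 4841 → item 4840 → crux (route `CurrentConnectionInvariance` alone);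
* `sig_ratioLimitExists_of_scalingLimit` : Stub 8 → any non-degenerate pointwise scaling limit gives Stub 1, with the
  in-edges from items 1981, 5355, 1344;
* `SpinRatioMoebius_of_moebiusLimit` : Stub 8 → Stub 10 → item 1344 → crux, and `SpinRatioMoebius_of_conformalLimit` :
  Stub 8 → Stub 10 → `Ising3DConformalLimit` → crux (the crux is NECESSARY for the summit conjunct);
* `one_le_ratioLimit` : Stub 7 → every ratio limit is `≥ 1` on the locus. -/

section Pinning

/-- Statement of `stub_prodPairsLe` (Stub 7). -/
def Sig.stub_prodPairsLe : Prop :=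
  ∀ (m : ℕ) (y : Fin (m + m) → Literature.Probability.LatticeModels.Site 3), Function.Injective y → ∏ j : Fin m, Literature.Probability.LatticeModels.criticalCorr 3 2 ![y (Fin.castAdd m j), y (Fin.natAdd m j)] ≤ Literature.Probability.LatticeModels.criticalCorr 3 (m + m) y

/-- Statement of `stub_ratioLimitOfScalingLimit` (Stub 8). -/
def Sig.stub_ratioLimitOfScalingLimit : Prop :=
  ∀ (ρ : ℝ → ℝ) (S : Literature.Probability.LatticeModels.CorrFamily 3), (∀ δ ∈ Set.Ioc (0:ℝ) 1, 0 < ρ δ) → Literature.Probability.LatticeModels.HasPointwiseScalingLimit (Literature.Probability.LatticeModels.criticalCorr 3) ρ S → Literature.Probability.LatticeModels.IsNondegenerateTwoPoint S → ∀ m : ℕ, TendstoLocallyUniformlyOn (fun (δ : ℝ) (x : Fin (m + m) → EuclideanSpace ℝ (Fin 3)) => Literature.Probability.LatticeModels.criticalCorr 3 (m + m) (fun i => Literature.Probability.LatticeModels.latticeApprox δ (x i)) / ∏ j : Fin m, Literature.Probability.LatticeModels.criticalCorr 3 2 ![Literature.Probability.LatticeModels.latticeApprox δ (x (Fin.castAdd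 m j)), Literature.Probability.LatticeModels.latticeApprox δ (x (Fin.natAdd m j))]) (fun x => S (m + m) x / ∏ j : Fin m, S 2 ![x (Fin.castAdd m j), x (Fin.natAdd m j)]) (nhdsWithin 0 (Set.Ioi 0)) (Literature.Probability.LatticeModels.NonCoincident 3 (m + m))

/-- Statement of `stub_ratioInversionOfCCI` (Stub 9). -/
def Sig.stub_ratioInversionOfCCI : Prop :=
  (∀ (m : ℕ) (y : Fin (m + m) → Literature.Probability.LatticeModels.Site 3), Function.Injective y → ∏ j : Fin m, Literature.Probability.LatticeModels.criticalCorr 3 2 ![y (Fin.castAdd m j), y (Fin.natAdd m j)] ≤ Literature.Probability.LatticeModels.criticalCorr 3 (m + m) y) → (∃ q : Literature.Probability.LatticeModels.CorrFamily 3, ∀ m : ℕ, TendstoLocallyUniformlyOn (fun (δ : ℝ) (x : Fin (m + m) → EuclideanSpace ℝ (Fin 3)) => Literature.Probability.LatticeModels.criticalCorr 3 (m + m) (fun i => Literature.Probability.LatticeModels.latticeApprox δ (x i)) / ∏ j : Fin m, Literature.Probability.LatticeModels.criticalCorr 3 2 ![Literature.Probability.LatticeModels.latticeApprox δ (x (Fin.castAdd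 m j)), Literature.Probability.LatticeModels.latticeApprox δ (x (Fin.natAdd m j))]) (q (m + m)) (nhdsWithin 0 (Set.Ioi 0)) (Literature.Probability.LatticeModels.NonCoincident 3 (m + m))) → Summit.CriticalPhenomena.Ising3DConformalLimit.Theses.CurrentConnectionInvariance.RatioInversionInvariance → ∀ (m : ℕ), ∀ x ∈ Literature.Probability.LatticeModels.NonCoincident 3 (m + m), (∀ i, x i ≠ 0) → Filter.Tendsto (fun δ : ℝ => Literature.Probability.LatticeModels.criticalCorr 3 (m + m) (fun i => Literature.Probability.LatticeModels.latticeApprox δ (EuclideanGeometry.inversion 0 1 (x i))) / (∏ j : Fin m, Literature.Probability.LatticeModels.criticalCorr 3 2 ![Literature.Probability.LatticeModels.latticeApprox δ (EuclideanGeometry.inversion 0 1 (x (Fin.castAdd m j))), Literature.Probability.LatticeModels.latticeApprox δ (EuclideanGeometry.inversion 0 1 (x (Fin.natAdd m j)))]) - Literature.Probability.LatticeModels.criticalCorr 3 (m + m) (fun i => Literature.Probability.LatticeModels.latticeApprox δ (x i)) / (∏ j : Fin m, Literature.Probability.LatticeModels.criticalCorr 3 2 ![Literature.Probability.LatticeModels.latticeApprox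 δ (x (Fin.castAdd m j)), Literature.Probability.LatticeModels.latticeApprox δ (x (Fin.natAdd m j))])) (nhdsWithin 0 (Set.Ioi 0)) (nhds 0)

/-- Statement of `stub_ratioOfCovariantFamily` (Stub 10). -/
def Sig.stub_ratioOfCovariantFamily : Prop :=
  ∀ (Δ : ℝ) (S : Literature.Probability.LatticeModels.CorrFamily 3), Literature.Probability.LatticeModels.IsMoebiusCovariant Δ S → ∀ (m : ℕ) (x : Fin (m + m) → EuclideanSpace ℝ (Fin 3)), (∀ v : EuclideanSpace ℝ (Fin 3), S (m + m) (fun i => x i + v) / (∏ j : Fin m, S 2 ![x (Fin.castAdd m j) + v, x (Fin.natAdd m j) + v]) = S (m + m) x / ∏ j : Fin m, S 2 ![x (Fin.castAdd m j), x (Fin.natAdd m j)]) ∧ (∀ A : EuclideanSpace ℝ (Fin 3) ≃ₗᵢ[ℝ] EuclideanSpace ℝ (Fin 3), S (m + m) (fun i => A (x i)) / (∏ j : Fin m, S 2 ![A (x (Fin.castAdd m j)), A (x (Fin.natAdd m j))]) = S (m + m) x / ∏ j : Fin m, S 2 ![x (Fin.castAdd m j), x (Fin.natAdd m j)]) ∧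 (∀ c : ℝ, 0 < c → S (m + m) (fun i => c • x i) / (∏ j : Fin m, S 2 ![c • x (Fin.castAdd m j), c • x (Fin.natAdd m j)]) = S (m + m) x / ∏ j : Fin m, S 2 ![x (Fin.castAdd m j), x (Fin.natAdd m j)]) ∧ ((∀ i, x i ≠ 0) → S (m + m) (fun i => EuclideanGeometry.inversion 0 1 (x i)) / (∏ j : Fin m, S 2 ![EuclideanGeometry.inversion 0 1 (x (Fin.castAdd m j)), EuclideanGeometry.inversion 0 1 (x (Fin.natAdd m j))]) = S (m + m) x / ∏ j : Fin m, S 2 ![x (Fin.castAdd m j), x (Fin.natAdd m j)])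

/-! ### §9.1 `Q ≥ 1`: every ratio limit is `≥ 1` on the locus (Stub 7) -/

/-- For a non-coincident configuration the pairing ratio is eventually `≥ 1` (Stub 7 at the eventually injective
lattice images). -/
theorem eventually_one_le_pairingRatio (h7 : Sig.stub_prodPairsLe) {m : ℕ} {x : Fin (m + m) → EuclideanSpace ℝ (Fin 3)}
    (hx : x ∈ NonCoincident 3 (m + m)) : ∀ᶠ δ in 𝓝[>] (0 : ℝ), 1 ≤ pairingRatio m δ x := by
  filter_upwards [eventually_injective_latticeApprox hx] with δ hδ
  unfold pairingRatio
  rw [le_div_iff₀ (Finset.prod_pos fun j _ =>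
    Cruxes.IsingEuclidUpgradeR4NonGaussian.FreeCovarianceDeltaDichotomy.criticalCorr_two_pos' _ _), one_mul]
  exact h7 m (fun i => latticeApprox δ (x i)) hδ

/-- Hence every locally uniform ratio limit is `≥ 1` (in particular `≠ 0`) on the locus. -/
theorem one_le_ratioLimit (h7 : Sig.stub_prodPairsLe) {m : ℕ} {g : (Fin (m + m) → EuclideanSpace ℝ (Fin 3)) → ℝ}
    (hg : TendstoLocallyUniformlyOn (pairingRatio m) g (𝓝[>] (0 : ℝ)) (NonCoincident 3 (m + m)))
    {x : Fin (m + m) → EuclideanSpace ℝ (Fin 3)} (hx : x ∈ NonCoincident 3 (m + m)) : 1 ≤ g x :=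
  ge_of_tendsto (hg.tendsto_at hx) (eventually_one_le_pairingRatio h7 hx)

/-! ### §9.2 The crux inside route `CurrentConnectionInvariance` (Stubs 7, 9; items 4841, 4840) -/

/-- **The crux from `stub_ratioLimitExists` and item stmt-CriticalPhenomena-4840** (Stub 9 supplies the inversion
stub, Stub 7 the cancellations; everything else landed or free). -/
theorem SpinRatioMoebius_of_CCI (h7 : Sig.stub_prodPairsLe) (h9 : Sig.stub_ratioInversionOfCCI) :
    Sig.stub_ratioLimitExists → CurrentConnectionInvariance.RatioInversionInvariance →
      Summit.CriticalPhenomena.Ising3DConformalLimit.Theses.LinkingParityCircles.SpinRatioMoebius :=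
  fun hL hI => SpinRatioMoebius_of hL (h9 h7 hL hI) stub_cellLimitTranslate stub_cellLimitContinuous
    stub_twoPointOfRatioLimit stub_scalingLimitOfRatioLimit

/-- **The crux from the two OPEN items 4841 `RatioLimit` and 4840 `RatioInversionInvariance` of route
`CurrentConnectionInvariance` alone** (kill criterion (d) of route `LinkingParityCircles`, kernel-checked modulo the
provable Stubs 7 and 9). -/
theorem SpinRatioMoebius_of_CCI_items (h7 : Sig.stub_prodPairsLe) (h9 : Sig.stub_ratioInversionOfCCI) :
    CurrentConnectionInvariance.RatioLimit → CurrentConnectionInvariance.RatioInversionInvariance →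
      Summit.CriticalPhenomena.Ising3DConformalLimit.Theses.LinkingParityCircles.SpinRatioMoebius :=
  fun hRL hI => SpinRatioMoebius_of_CCI h7 h9 (ratioLimitExists_of_CCIRatioLimit hRL) hI

/-! ### §9.3 Ratio limits from any non-degenerate scaling limit (Stub 8; items 1981, 5355, 1344) -/

/-- The pairing quotient of a continuum family at level `m`: `S_{2m}(x) / ∏_j S_2(x_j, x_{j+m})`. -/
def pairingQuot (S : CorrFamily 3) (m : ℕ) (x : Fin (m + m) → EuclideanSpace ℝ (Fin 3)) : ℝ :=
  S (m + m) x / ∏ j : Fin m, S 2 ![x (Fin.castAdd m j), x (Fin.natAdd m j)]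

/-- Its packaging as a `CorrFamily 3`: at arity `n` read the first `n/2 + n/2` coordinates (all of them when `n`
is even) through `pairingQuot S (n/2)`. -/
def quotFamily (S : CorrFamily 3) : CorrFamily 3 :=
  fun n x => pairingQuot S (n / 2) (fun i => x (Fin.castLE (by omega) i))

/-- At even arity the packaged family is the pairing quotient. -/
theorem quotFamily_even (S : CorrFamily 3) (m : ℕ) (x : Fin (m + m) → EuclideanSpace ℝ (Fin 3)) :
    quotFamily S (m + m) x = pairingQuot S m x := by
  have key : ∀ (k : ℕ) (hk : k = m) (h : k + k ≤ m + m),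
      pairingQuot S k (fun i => x (Fin.castLE h i)) = pairingQuot S m x := by
    intro k hk h
    subst hk
    rfl
  exact key ((m + m) / 2) (by omega) _

/-- **Stub 1 from a scaling limit** (Stub 8, packaged): the pairing ratios converge to `quotFamily S` at every level. -/
theorem ratioLimit_of_scalingLimit (h8 : Sig.stub_ratioLimitOfScalingLimit) {ρ : ℝ → ℝ} {S : CorrFamily 3}
    (hρ : ∀ δ ∈ Set.Ioc (0 : ℝ) 1, 0 < ρ δ) (hlim : HasPointwiseScalingLimit (criticalCorr 3) ρ S)
    (hnd : IsNondegenerateTwoPoint S) (m : ℕ) :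
    TendstoLocallyUniformlyOn (pairingRatio m) (quotFamily S (m + m)) (𝓝[>] (0 : ℝ)) (NonCoincident 3 (m + m)) :=
  (h8 ρ S hρ hlim hnd m).congr_right fun x _ => (quotFamily_even S m x).symm

/-- Hence ANY non-degenerate pointwise scaling limit of the critical correlators gives `Sig.stub_ratioLimitExists`. -/
theorem sig_ratioLimitExists_of_scalingLimit (h8 : Sig.stub_ratioLimitOfScalingLimit) {ρ : ℝ → ℝ} {S : CorrFamily 3}
    (hρ : ∀ δ ∈ Set.Ioc (0 : ℝ) 1, 0 < ρ δ) (hlim : HasPointwiseScalingLimit (criticalCorr 3) ρ S)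
    (hnd : IsNondegenerateTwoPoint S) : Sig.stub_ratioLimitExists :=
  ⟨quotFamily S, ratioLimit_of_scalingLimit h8 hρ hlim hnd⟩

/-- In-edge: item stmt-CriticalPhenomena-1981 `HyperoctahedralRP.ExistsScaleCovariantLimit` ⇒ Stub 1. -/
theorem sig_ratioLimitExists_of_existsScaleCovariantLimit (h8 : Sig.stub_ratioLimitOfScalingLimit) :
    HyperoctahedralRP.ExistsScaleCovariantLimit → Sig.stub_ratioLimitExists :=
  fun ⟨_, _, _, hρ, _, hlim, _, hnd, _, _⟩ => sig_ratioLimitExists_of_scalingLimit h8 hρ hlim hnd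

/-- In-edge: item stmt-CriticalPhenomena-5355 `PrimaryAtInfinity.ExistsRegularLimit` ⇒ Stub 1. -/
theorem sig_ratioLimitExists_of_existsRegularLimit (h8 : Sig.stub_ratioLimitOfScalingLimit) :
    PrimaryAtInfinity.ExistsRegularLimit → Sig.stub_ratioLimitExists :=
  fun ⟨_, _, hρ, hlim, _, hnd, _, _, _⟩ => sig_ratioLimitExists_of_scalingLimit h8 hρ hlim hnd

/-- In-edge: item stmt-CriticalPhenomena-1344 `MoebiusLimit` (the conjunct minus (iii)) ⇒ Stub 1. -/
theorem sig_ratioLimitExists_of_moebiusLimit (h8 : Sig.stub_ratioLimitOfScalingLimit) :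
    EnergyNotSigmaSquared.MoebiusLimit → Sig.stub_ratioLimitExists :=
  fun ⟨_, _, _, hρ, _, hlim, hnd, _⟩ => sig_ratioLimitExists_of_scalingLimit h8 hρ hlim hnd

/-! ### §9.4 The crux is NECESSARY: `MoebiusLimit` (item 1344) ⇒ crux, `Ising3DConformalLimit` ⇒ crux (Stubs 8, 10) -/

/-- **The crux from item stmt-CriticalPhenomena-1344 `MoebiusLimit`**: the normalised pairing quotients of a
Möbius covariant non-degenerate scaling limit are a Möbius INVARIANT family of ratio limits. -/
theorem SpinRatioMoebius_of_moebiusLimit (h8 : Sig.stub_ratioLimitOfScalingLimit) (h10 : Sig.stub_ratioOfCovariantFamily) :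
    EnergyNotSigmaSquared.MoebiusLimit →
      Summit.CriticalPhenomena.Ising3DConformalLimit.Theses.LinkingParityCircles.SpinRatioMoebius := by
  rintro ⟨ρ, Δ, S, hρ, -, hlim, hnd, hM⟩
  have hq := ratioLimit_of_scalingLimit h8 hρ hlim hnd
  refine ⟨normalise (quotFamily S), ⟨⟨?_, ?_⟩, ?_, ?_⟩, ?_⟩
  · -- translations
    intro n v x
    have hφ : Function.Injective (fun y : EuclideanSpace ℝ (Fin 3) => y + v) := add_left_injective v
    by_cases h : Even n ∧ x ∈ NonCoincident 3 n
    · obtain ⟨⟨m, rfl⟩, hx⟩ := h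
      have hxv : (fun i => x i + v) ∈ NonCoincident 3 (m + m) := (comp_mem_nonCoincident_iff hφ x).2 hx
      rw [normalise_of_pos ⟨m, rfl⟩ hxv, normalise_of_pos ⟨m, rfl⟩ hx, quotFamily_even, quotFamily_even]
      exact (h10 Δ S hM m x).1 v
    · have h' : ¬ (Even n ∧ (fun i => x i + v) ∈ NonCoincident 3 n) := fun hh =>
        h ⟨hh.1, (comp_mem_nonCoincident_iff hφ x).1 hh.2⟩
      rw [normalise_of_neg h', normalise_of_neg h]
  · -- linear isometries
    intro n A x
    by_cases h : Even n ∧ x ∈ NonCoincident 3 n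
    · obtain ⟨⟨m, rfl⟩, hx⟩ := h
      have hAx : (fun i => A (x i)) ∈ NonCoincident 3 (m + m) := (comp_mem_nonCoincident_iff A.injective x).2 hx
      rw [normalise_of_pos ⟨m, rfl⟩ hAx, normalise_of_pos ⟨m, rfl⟩ hx, quotFamily_even, quotFamily_even]
      exact (h10 Δ S hM m x).2.1 A
    · have h' : ¬ (Even n ∧ (fun i => A (x i)) ∈ NonCoincident 3 n) := fun hh =>
        h ⟨hh.1, (comp_mem_nonCoincident_iff A.injective x).1 hh.2⟩
      rw [normalise_of_neg h', normalise_of_neg h]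
  · -- dilations, weight 0
    intro n c hc x
    have hc1 : c ^ (-(n : ℝ) * 0) = 1 := by
      rw [mul_zero, Real.rpow_zero]
    rw [hc1, one_mul]
    have hφ : Function.Injective (fun y : EuclideanSpace ℝ (Fin 3) => c • y) := smul_right_injective _ hc.ne'
    by_cases h : Even n ∧ x ∈ NonCoincident 3 n
    · obtain ⟨⟨m, rfl⟩, hx⟩ := h
      have hcx : (fun i => c • x i) ∈ NonCoincident 3 (m + m) := (comp_mem_nonCoincident_iff hφ x).2 hx
      rw [normalise_of_pos ⟨m, rfl⟩ hcx, normalise_of_pos ⟨m, rfl⟩ hx, quotFamily_even, quotFamily_even]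
      exact (h10 Δ S hM m x).2.2.1 c hc
    · have h' : ¬ (Even n ∧ (fun i => c • x i) ∈ NonCoincident 3 n) := fun hh =>
        h ⟨hh.1, (comp_mem_nonCoincident_iff hφ x).1 hh.2⟩
      rw [normalise_of_neg h', normalise_of_neg h]
  · -- the unit inversion, weight 0
    intro n x hx0
    have hw : (∏ i : Fin n, ‖x i‖ ^ (2 * (0 : ℝ))) = 1 := by
      simp
    rw [hw, one_mul]
    have hφ : Function.Injective (EuclideanGeometry.inversion (0 : EuclideanSpace ℝ (Fin 3)) 1) :=
      EuclideanGeometry.inversion_injective _ one_ne_zero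
    by_cases h : Even n ∧ x ∈ NonCoincident 3 n
    · obtain ⟨⟨m, rfl⟩, hx⟩ := h
      have hix : (fun i => EuclideanGeometry.inversion 0 1 (x i)) ∈ NonCoincident 3 (m + m) :=
        (comp_mem_nonCoincident_iff hφ x).2 hx
      rw [normalise_of_pos ⟨m, rfl⟩ hix, normalise_of_pos ⟨m, rfl⟩ hx, quotFamily_even, quotFamily_even]
      exact (h10 Δ S hM m x).2.2.2 hx0
    · have h' : ¬ (Even n ∧ (fun i => EuclideanGeometry.inversion 0 1 (x i)) ∈ NonCoincident 3 n) := fun hh =>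
        h ⟨hh.1, (comp_mem_nonCoincident_iff hφ x).1 hh.2⟩
      rw [normalise_of_neg h', normalise_of_neg h]
  · -- the convergence clause
    intro m
    exact (hq m).congr_right fun x hx => (normalise_of_pos ⟨m, rfl⟩ hx).symm

/-- **The crux is necessary for the summit conjunct**: `Ising3DConformalLimit → SpinRatioMoebius` (drop clause (iii)
and apply `SpinRatioMoebius_of_moebiusLimit`).  Honest-route certificate for the k = 0 corner of `LinkingParityCircles`. -/
theorem SpinRatioMoebius_of_conformalLimit (h8 : Sig.stub_ratioLimitOfScalingLimit) (h10 : Sig.stub_ratioOfCovariantFamily) :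
    _root_.Ising3DConformalLimit →
      Summit.CriticalPhenomena.Ising3DConformalLimit.Theses.LinkingParityCircles.SpinRatioMoebius :=
  fun ⟨ρ, Δ, S, hρ, hΔ, hlim, hnd, hM, _⟩ => SpinRatioMoebius_of_moebiusLimit h8 h10 ⟨ρ, Δ, S, hρ, hΔ, hlim, hnd, hM⟩

/-! ### §9.5 The same, fed the registered stubs (kernel-checks that each `Sig.stub_X` IS the signature of `stub_X`) -/

/-- The crux from items 4841 and 4840, modulo the provable Stubs 7 and 9. -/
theorem SpinRatioMoebius_of_CCI_stubs :
    CurrentConnectionInvariance.RatioLimit → CurrentConnectionInvariance.RatioInversionInvariance →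
      Summit.CriticalPhenomena.Ising3DConformalLimit.Theses.LinkingParityCircles.SpinRatioMoebius :=
  SpinRatioMoebius_of_CCI_items stub_prodPairsLe stub_ratioInversionOfCCI

/-- The crux from item 1344, modulo the provable Stubs 8 and 10. -/
theorem SpinRatioMoebius_of_moebiusLimit_stubs :
    EnergyNotSigmaSquared.MoebiusLimit →
      Summit.CriticalPhenomena.Ising3DConformalLimit.Theses.LinkingParityCircles.SpinRatioMoebius :=
  SpinRatioMoebius_of_moebiusLimit stub_ratioLimitOfScalingLimit stub_ratioOfCovariantFamily

/-- The crux from the conjunct, modulo the provable Stubs 8 and 10. -/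
theorem SpinRatioMoebius_of_conformalLimit_stubs :
    _root_.Ising3DConformalLimit →
      Summit.CriticalPhenomena.Ising3DConformalLimit.Theses.LinkingParityCircles.SpinRatioMoebius :=
  SpinRatioMoebius_of_conformalLimit stub_ratioLimitOfScalingLimit stub_ratioOfCovariantFamily

/-- Stub 1 from items 1981 / 5355 / 1344, modulo the provable Stub 8. -/
theorem stub_ratioLimitExists_inEdges :
    (HyperoctahedralRP.ExistsScaleCovariantLimit → Sig.stub_ratioLimitExists) ∧
    (PrimaryAtInfinity.ExistsRegularLimit → Sig.stub_ratioLimitExists) ∧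
    (EnergyNotSigmaSquared.MoebiusLimit → Sig.stub_ratioLimitExists) :=
  ⟨sig_ratioLimitExists_of_existsScaleCovariantLimit stub_ratioLimitOfScalingLimit,
    sig_ratioLimitExists_of_existsRegularLimit stub_ratioLimitOfScalingLimit,
    sig_ratioLimitExists_of_moebiusLimit stub_ratioLimitOfScalingLimit⟩

end Pinning

/-! ## §10 Reshape 2, CONVERSES (for the planners): the crux IMPLIES items 1344, 4841, 4840, 4842

Four further registered sub-goals (Stubs 11–14, ALL LANDED in wave 3) and their sorry-free compositions.  Together with §9 they
kernel-check the equivalence web `SpinRatioMoebius ⇔ MoebiusLimit (1344) ⇔ RatioLimit (4841) ∧ RatioInversionInvariance (4840)`,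
`stub_ratioLimitExists ⇔ RatioLimit (4841)`, and `RatioLimit (4841) ⇒ RatioRotationInvariance (4842)`. -/

section Converses

-- Stubs 11–14 (`stub_inversionCovariantOfInvariantRatios`, `stub_telescopingLimitOfScalingLimit`, `stub_CCIRatioRotationOfLimit`,
-- `stub_CCIRatioInversionOfLimit`) are LANDED (wave 3 of the continuation lead: p156824, p156813, p156812, p156823) and imported:
-- `Theorems/LinkingParityCirclesSpinRatioMoebiusStub{InversionCovariantOfInvariantRatios,TelescopingLimitOfScalingLimit,CCIRatioRotationOfLimit,CCIRatioInversionOfLimit}.lean`.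

/-- Statement of Stub 11. -/
def Sig.stub_inversionCovariantOfInvariantRatios : Prop :=
  ∀ (ρ : ℝ → ℝ) (Δ : ℝ) (ψ : EuclideanSpace ℝ (Fin 3) → ℝ) (S q : Literature.Probability.LatticeModels.CorrFamily 3), Literature.Probability.LatticeModels.HasPointwiseScalingLimit (Literature.Probability.LatticeModels.criticalCorr 3) ρ S → (∀ (n : ℕ) (z : Fin n → EuclideanSpace ℝ (Fin 3)), z ∉ Literature.Probability.LatticeModels.NonCoincident 3 n → S n z = 0) → Literature.Probability.LatticeModels.IsScaleCovariant Δ S → Literature.Probability.LatticeModels.IsRotationInvariant S → (∀ u : EuclideanSpace ℝ (Fin 3), u ≠ 0 → 0 < ψ u) → (∀ m : ℕ, ∀ x ∈ Literature.Probability.LatticeModels.NonCoincident 3 (m + m), S (m + m) x = q (m + m) x * ∏ j : Fin m, ψ (x (Fin.natAdd m j) - x (Fin.castAdd m j))) → (∀ a b : EuclideanSpace ℝ (Fin 3), a ≠ b → S 2 ![a, b] = ψ (b - a)) → (∀ m : ℕ, ∀ x ∈ Literature.Probability.LatticeModels.NonCoincident 3 (m + m), (∀ i, x i ≠ 0) →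 q (m + m) (fun i => EuclideanGeometry.inversion 0 1 (x i)) = q (m + m) x) → Literature.Probability.LatticeModels.IsInversionCovariant Δ S

/-- Statement of Stub 12. -/
def Sig.stub_telescopingLimitOfScalingLimit : Prop :=
  ∀ (ρ : ℝ → ℝ) (S : Literature.Probability.LatticeModels.CorrFamily 3), (∀ δ ∈ Set.Ioc (0:ℝ) 1, 0 < ρ δ) → Literature.Probability.LatticeModels.HasPointwiseScalingLimit (Literature.Probability.LatticeModels.criticalCorr 3) ρ S → Literature.Probability.LatticeModels.IsNondegenerateTwoPoint S → ∀ n : ℕ, Even n → ContinuousOn (fun z : Fin (n + 2) → EuclideanSpace ℝ (Fin 3) => S n (fun i => z (Fin.castAdd 2 i)) * S 2 (fun i => z (Fin.natAdd n i)) / S (n + 2) z) (Literature.Probability.LatticeModels.NonCoincident 3 (n + 2)) ∧ (∀ z ∈ Literature.Probability.LatticeModels.NonCoincident 3 (n + 2), 0 < S n (fun i => z (Fin.castAdd 2 i)) * S 2 (fun i => z (Fin.natAdd n i)) / S (n + 2) z) ∧ TendstoLocallyUniformlyOn (fun (δ : ℝ) (z : Fin (n + 2) → EuclideanSpace ℝ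 (Fin 3)) => Literature.Probability.LatticeModels.rescaledCorrelator (Literature.Probability.LatticeModels.criticalCorr 3) 1 n δ (fun i => z (Fin.castAdd 2 i)) * Literature.Probability.LatticeModels.rescaledCorrelator (Literature.Probability.LatticeModels.criticalCorr 3) 1 2 δ (fun i => z (Fin.natAdd n i)) / Literature.Probability.LatticeModels.rescaledCorrelator (Literature.Probability.LatticeModels.criticalCorr 3) 1 (n + 2) δ z) (fun z => S n (fun i => z (Fin.castAdd 2 i)) * S 2 (fun i => z (Fin.natAdd n i)) / S (n + 2) z) (nhdsWithin 0 (Set.Ioi 0)) (Literature.Probability.LatticeModels.NonCoincident 3 (n + 2))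

/-- Statement of Stub 13. -/
def Sig.stub_CCIRatioRotationOfLimit : Prop :=
  ∀ (S : Literature.Probability.LatticeModels.CorrFamily 3), Literature.Probability.LatticeModels.IsRotationInvariant S → (∀ n : ℕ, Even n → TendstoLocallyUniformlyOn (fun (δ : ℝ) (z : Fin (n + 2) → EuclideanSpace ℝ (Fin 3)) => Literature.Probability.LatticeModels.rescaledCorrelator (Literature.Probability.LatticeModels.criticalCorr 3) 1 n δ (fun i => z (Fin.castAdd 2 i)) * Literature.Probability.LatticeModels.rescaledCorrelator (Literature.Probability.LatticeModels.criticalCorr 3) 1 2 δ (fun i => z (Fin.natAdd n i)) / Literature.Probability.LatticeModels.rescaledCorrelator (Literature.Probability.LatticeModels.criticalCorr 3) 1 (n + 2) δ z) (fun z => S n (fun i => z (Fin.castAdd 2 i)) * S 2 (fun i => z (Fin.natAdd n i)) / S (n + 2) z) (nhdsWithin 0 (Set.Ioi 0)) (Literature.Probability.LatticeModels.NonCoincident 3 (n + 2))) → Summit.CriticalPhenomena.Ising3DConformalLimit.Theses.CurrentConnectionInvariance.RatioRotationInvariance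

/-- Statement of Stub 14. -/
def Sig.stub_CCIRatioInversionOfLimit : Prop :=
  ∀ (Δ : ℝ) (S : Literature.Probability.LatticeModels.CorrFamily 3), Literature.Probability.LatticeModels.IsInversionCovariant Δ S → (∀ n : ℕ, Even n → TendstoLocallyUniformlyOn (fun (δ : ℝ) (z : Fin (n + 2) → EuclideanSpace ℝ (Fin 3)) => Literature.Probability.LatticeModels.rescaledCorrelator (Literature.Probability.LatticeModels.criticalCorr 3) 1 n δ (fun i => z (Fin.castAdd 2 i)) * Literature.Probability.LatticeModels.rescaledCorrelator (Literature.Probability.LatticeModels.criticalCorr 3) 1 2 δ (fun i => z (Fin.natAdd n i)) / Literature.Probability.LatticeModels.rescaledCorrelator (Literature.Probability.LatticeModels.criticalCorr 3) 1 (n + 2) δ z) (fun z => S n (fun i => z (Fin.castAdd 2 i)) * S 2 (fun i => z (Fin.natAdd n i)) / S (n + 2) z) (nhdsWithin 0 (Set.Ioi 0)) (Literature.Probability.LatticeModels.NonCoincident 3 (n + 2))) → Summit.CriticalPhenomena.Ising3DConformalLimit.Theses.CurrentConnectionInvariance.RatioInversionInvariance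

/-! ### §10.1 The crux ⇒ item 1344 `MoebiusLimit` (Stub 11): hence `SpinRatioMoebius ⇔ MoebiusLimit` -/

/-- **crux ⇒ item 1344**: the pinned scaling limit of a Möbius INVARIANT family of ratio limits is inversion covariant
(Stub 11), and "existence + unit-inversion covariance" is `MoebiusLimit` (`MoebiusLimitExistsNegative.moebiusLimit_iff_inversion`:
translations, dilations, `0 < Δ` and `O(3)` are automatic). -/
theorem moebiusLimit_of_SpinRatioMoebius (h11 : Sig.stub_inversionCovariantOfInvariantRatios) :
    Summit.CriticalPhenomena.Ising3DConformalLimit.Theses.LinkingParityCircles.SpinRatioMoebius →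
      EnergyNotSigmaSquared.MoebiusLimit := by
  rintro ⟨q, hMq, hq⟩
  obtain ⟨ρ, Δ, ψ, S, hρ, hS, hnorm, hnd, -, hsc, hrot, hψpos, hform, hS2⟩ :=
    exists_pinnedLimit stub_cellLimitTranslate stub_cellLimitContinuous stub_twoPointOfRatioLimit
      stub_scalingLimitOfRatioLimit hq
  have hqinv : ∀ m : ℕ, ∀ x ∈ NonCoincident 3 (m + m), (∀ i, x i ≠ 0) →
      q (m + m) (fun i => EuclideanGeometry.inversion 0 1 (x i)) = q (m + m) x := by
    intro m x _ hx0
    have h := hMq.2.2 (m + m) x hx0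
    have hw : (∏ i : Fin (m + m), ‖x i‖ ^ (2 * (0 : ℝ))) = 1 := by simp
    rw [hw, one_mul] at h
    exact h
  exact MoebiusLimitExistsNegative.moebiusLimit_iff_inversion.2
    ⟨ρ, Δ, S, hρ, hS, hnd, h11 ρ Δ ψ S q hS hnorm hsc hrot hψpos hform hS2 hqinv⟩

/-- **`SpinRatioMoebius ⇔ MoebiusLimit (item 1344)`**, modulo the provable Stubs 8, 10, 11. -/
theorem SpinRatioMoebius_iff_moebiusLimit (h8 : Sig.stub_ratioLimitOfScalingLimit) (h10 : Sig.stub_ratioOfCovariantFamily)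
    (h11 : Sig.stub_inversionCovariantOfInvariantRatios) :
    Summit.CriticalPhenomena.Ising3DConformalLimit.Theses.LinkingParityCircles.SpinRatioMoebius ↔
      EnergyNotSigmaSquared.MoebiusLimit :=
  ⟨moebiusLimit_of_SpinRatioMoebius h11, SpinRatioMoebius_of_moebiusLimit h8 h10⟩

/-! ### §10.2 Scaling limits ⇒ items 4841 / 4842 / 4840 (Stubs 12–14) -/

/-- Item 4841 `RatioLimit` from ANY non-degenerate pointwise scaling limit (Stub 12). -/
theorem CCIRatioLimit_of_scalingLimit (h12 : Sig.stub_telescopingLimitOfScalingLimit) {ρ : ℝ → ℝ} {S : CorrFamily 3}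
    (hρ : ∀ δ ∈ Set.Ioc (0 : ℝ) 1, 0 < ρ δ) (hlim : HasPointwiseScalingLimit (criticalCorr 3) ρ S)
    (hnd : IsNondegenerateTwoPoint S) : CurrentConnectionInvariance.RatioLimit := by
  intro n hn _
  obtain ⟨hc, hpos, hT⟩ := h12 ρ S hρ hlim hnd n hn
  exact ⟨_, hc, hpos, hT⟩

/-- Item 4842 `RatioRotationInvariance` from any non-degenerate `O(3)`-invariant pointwise scaling limit (Stubs 12, 13). -/
theorem CCIRatioRotation_of_scalingLimit (h12 : Sig.stub_telescopingLimitOfScalingLimit) (h13 : Sig.stub_CCIRatioRotationOfLimit)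
    {ρ : ℝ → ℝ} {S : CorrFamily 3} (hρ : ∀ δ ∈ Set.Ioc (0 : ℝ) 1, 0 < ρ δ)
    (hlim : HasPointwiseScalingLimit (criticalCorr 3) ρ S) (hnd : IsNondegenerateTwoPoint S) (hrot : IsRotationInvariant S) :
    CurrentConnectionInvariance.RatioRotationInvariance :=
  h13 S hrot fun n hn => (h12 ρ S hρ hlim hnd n hn).2.2

/-- Item 4840 `RatioInversionInvariance` from any non-degenerate inversion covariant pointwise scaling limit (Stubs 12, 14). -/
theorem CCIRatioInversion_of_scalingLimit (h12 : Sig.stub_telescopingLimitOfScalingLimit) (h14 : Sig.stub_CCIRatioInversionOfLimit)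
    {ρ : ℝ → ℝ} {Δ : ℝ} {S : CorrFamily 3} (hρ : ∀ δ ∈ Set.Ioc (0 : ℝ) 1, 0 < ρ δ)
    (hlim : HasPointwiseScalingLimit (criticalCorr 3) ρ S) (hnd : IsNondegenerateTwoPoint S) (hinv : IsInversionCovariant Δ S) :
    CurrentConnectionInvariance.RatioInversionInvariance :=
  h14 Δ S hinv fun n hn => (h12 ρ S hρ hlim hnd n hn).2.2

/-- **`stub_ratioLimitExists ⇒ item 4841`** (the pinned limit exists), so that with the landed bridge
`ratioLimitExists_of_CCIRatioLimit`: `stub_ratioLimitExists ⇔ RatioLimit (4841)`. -/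
theorem CCIRatioLimit_of_ratioLimitExists (h12 : Sig.stub_telescopingLimitOfScalingLimit) :
    Sig.stub_ratioLimitExists → CurrentConnectionInvariance.RatioLimit := by
  intro hL
  obtain ⟨q, hq⟩ := sig_ratioLimitExists_iff.1 hL
  obtain ⟨ρ, Δ, ψ, S, hρ, hS, -, hnd, -⟩ :=
    exists_pinnedLimit stub_cellLimitTranslate stub_cellLimitContinuous stub_twoPointOfRatioLimit
      stub_scalingLimitOfRatioLimit hq
  exact CCIRatioLimit_of_scalingLimit h12 hρ hS hnd

/-- `stub_ratioLimitExists ⇔ item 4841`, modulo the provable Stub 12. -/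
theorem ratioLimitExists_iff_CCIRatioLimit (h12 : Sig.stub_telescopingLimitOfScalingLimit) :
    Sig.stub_ratioLimitExists ↔ CurrentConnectionInvariance.RatioLimit :=
  ⟨CCIRatioLimit_of_ratioLimitExists h12, ratioLimitExists_of_CCIRatioLimit⟩

/-- **Item 4841 ⇒ item 4842** inside route `CurrentConnectionInvariance` (rotation invariance of the telescoping ratios is
FREE given their limits: the pinned limit is `O(3)` invariant by the landed `HyperoctahedralRP` rigidity). -/
theorem CCIRatioRotation_of_CCIRatioLimit (h12 : Sig.stub_telescopingLimitOfScalingLimit) (h13 : Sig.stub_CCIRatioRotationOfLimit) :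
    CurrentConnectionInvariance.RatioLimit → CurrentConnectionInvariance.RatioRotationInvariance := by
  intro hRL
  obtain ⟨q, hq⟩ := sig_ratioLimitExists_iff.1 (ratioLimitExists_of_CCIRatioLimit hRL)
  obtain ⟨ρ, Δ, ψ, S, hρ, hS, -, hnd, -, -, hrot, -⟩ :=
    exists_pinnedLimit stub_cellLimitTranslate stub_cellLimitContinuous stub_twoPointOfRatioLimit
      stub_scalingLimitOfRatioLimit hq
  exact CCIRatioRotation_of_scalingLimit h12 h13 hρ hS hnd hrot

/-- **Item 1344 ⇒ items 4841 ∧ 4842 ∧ 4840.** -/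
theorem CCI_items_of_moebiusLimit (h12 : Sig.stub_telescopingLimitOfScalingLimit) (h13 : Sig.stub_CCIRatioRotationOfLimit)
    (h14 : Sig.stub_CCIRatioInversionOfLimit) :
    EnergyNotSigmaSquared.MoebiusLimit → CurrentConnectionInvariance.RatioLimit ∧
      CurrentConnectionInvariance.RatioRotationInvariance ∧ CurrentConnectionInvariance.RatioInversionInvariance :=
  fun ⟨_, _, _, hρ, _, hlim, hnd, hM⟩ =>
    ⟨CCIRatioLimit_of_scalingLimit h12 hρ hlim hnd, CCIRatioRotation_of_scalingLimit h12 h13 hρ hlim hnd hM.1.2,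
      CCIRatioInversion_of_scalingLimit h12 h14 hρ hlim hnd hM.2.2⟩

/-- **crux ⇒ items 4841 ∧ 4842 ∧ 4840** (through item 1344), closing the circle with `SpinRatioMoebius_of_CCI_items`:
`SpinRatioMoebius ⇔ RatioLimit ∧ RatioInversionInvariance`. -/
theorem CCI_items_of_SpinRatioMoebius (h11 : Sig.stub_inversionCovariantOfInvariantRatios)
    (h12 : Sig.stub_telescopingLimitOfScalingLimit) (h13 : Sig.stub_CCIRatioRotationOfLimit) (h14 : Sig.stub_CCIRatioInversionOfLimit) :
    Summit.CriticalPhenomena.Ising3DConformalLimit.Theses.LinkingParityCircles.SpinRatioMoebius →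
      CurrentConnectionInvariance.RatioLimit ∧ CurrentConnectionInvariance.RatioRotationInvariance ∧
        CurrentConnectionInvariance.RatioInversionInvariance :=
  fun h => CCI_items_of_moebiusLimit h12 h13 h14 (moebiusLimit_of_SpinRatioMoebius h11 h)

/-- **`SpinRatioMoebius ⇔ RatioLimit (4841) ∧ RatioInversionInvariance (4840)`**, modulo the provable Stubs 7, 9, 11, 12, 14. -/
theorem SpinRatioMoebius_iff_CCI_items (h7 : Sig.stub_prodPairsLe) (h9 : Sig.stub_ratioInversionOfCCI)
    (h11 : Sig.stub_inversionCovariantOfInvariantRatios) (h12 : Sig.stub_telescopingLimitOfScalingLimit)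
    (h13 : Sig.stub_CCIRatioRotationOfLimit) (h14 : Sig.stub_CCIRatioInversionOfLimit) :
    Summit.CriticalPhenomena.Ising3DConformalLimit.Theses.LinkingParityCircles.SpinRatioMoebius ↔
      CurrentConnectionInvariance.RatioLimit ∧ CurrentConnectionInvariance.RatioInversionInvariance :=
  ⟨fun h => ⟨(CCI_items_of_SpinRatioMoebius h11 h12 h13 h14 h).1, (CCI_items_of_SpinRatioMoebius h11 h12 h13 h14 h).2.2⟩,
    fun h => SpinRatioMoebius_of_CCI_items h7 h9 h.1 h.2⟩

/-! ### §10.3 Fed the registered stubs -/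

/-- `SpinRatioMoebius ⇔ MoebiusLimit`, modulo Stubs 8, 10 (landed) and 11. -/
theorem SpinRatioMoebius_iff_moebiusLimit_stubs :
    Summit.CriticalPhenomena.Ising3DConformalLimit.Theses.LinkingParityCircles.SpinRatioMoebius ↔
      EnergyNotSigmaSquared.MoebiusLimit :=
  SpinRatioMoebius_iff_moebiusLimit stub_ratioLimitOfScalingLimit stub_ratioOfCovariantFamily
    stub_inversionCovariantOfInvariantRatios

/-- `SpinRatioMoebius ⇔ RatioLimit ∧ RatioInversionInvariance`, modulo Stubs 7, 9 (landed) and 11, 12, 13, 14. -/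
theorem SpinRatioMoebius_iff_CCI_items_stubs :
    Summit.CriticalPhenomena.Ising3DConformalLimit.Theses.LinkingParityCircles.SpinRatioMoebius ↔
      CurrentConnectionInvariance.RatioLimit ∧ CurrentConnectionInvariance.RatioInversionInvariance :=
  SpinRatioMoebius_iff_CCI_items stub_prodPairsLe stub_ratioInversionOfCCI stub_inversionCovariantOfInvariantRatios
    stub_telescopingLimitOfScalingLimit stub_CCIRatioRotationOfLimit stub_CCIRatioInversionOfLimit

/-- `stub_ratioLimitExists ⇔ RatioLimit (4841)` and `RatioLimit (4841) ⇒ RatioRotationInvariance (4842)`, modulo Stubs 12, 13. -/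
theorem CCI_internal_stubs :
    (Sig.stub_ratioLimitExists ↔ CurrentConnectionInvariance.RatioLimit) ∧
    (CurrentConnectionInvariance.RatioLimit → CurrentConnectionInvariance.RatioRotationInvariance) :=
  ⟨ratioLimitExists_iff_CCIRatioLimit stub_telescopingLimitOfScalingLimit,
    CCIRatioRotation_of_CCIRatioLimit stub_telescopingLimitOfScalingLimit stub_CCIRatioRotationOfLimit⟩

end Converses

/-! ## §11 Cycle 3 (continuation lead c2): the line is TIGHT — `crux ⇔ Stub 1 ∧ Stub 2`, `Stub 2 ⇔ item 4840` given Stub 1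

LANDED in `Theorems/LinkingParityCirclesSpinRatioMoebiusLineTightness.lean` (p160148: registered sub-goals
`SpinRatioMoebius_iff_ratioLimits_and_ratioInversion`, `ratioInversion_iff_CCIRatioInversion_of_ratioLimits`; that file imports the
landed Equivalences file, whose theorem names coincide with §9–§10 here, so it is not imported: the same statements are re-derived
below from this file's own glue, fed the `Sig.stub_…` propositions). -/

section Tightness

/-- The crux ⇒ Stub 1 (forget the covariance). -/
theorem sig_ratioLimitExists_of_SpinRatioMoebius
    (h : Summit.CriticalPhenomena.Ising3DConformalLimit.Theses.LinkingParityCircles.SpinRatioMoebius) :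
    Sig.stub_ratioLimitExists :=
  let ⟨q, _, hq⟩ := h
  ⟨q, hq⟩

/-- The crux ⇒ Stub 2 (directly: pointwise convergence at `x` and `ι ∘ x` to an inversion INVARIANT limit). -/
theorem sig_ratioInversion_of_SpinRatioMoebius
    (h : Summit.CriticalPhenomena.Ising3DConformalLimit.Theses.LinkingParityCircles.SpinRatioMoebius) :
    Sig.stub_ratioInversion := by
  obtain ⟨q, hMq, hq⟩ := h
  rw [sig_ratioInversion_iff]
  intro m x hx hx0
  have hιx : (fun i => EuclideanGeometry.inversion 0 1 (x i)) ∈ NonCoincident 3 (m + m) :=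
    (comp_mem_nonCoincident_iff (EuclideanGeometry.inversion_injective _ one_ne_zero) x).2 hx
  refine asymptotic_of_limit_eq (hq m) hx hιx ?_
  have h := hMq.2.2 (m + m) x hx0
  have hw : (∏ i : Fin (m + m), ‖x i‖ ^ (2 * (0 : ℝ))) = 1 := by simp
  rwa [hw, one_mul] at h

/-- **`SpinRatioMoebius ⇔ Sig.stub_ratioLimitExists ∧ Sig.stub_ratioInversion`**: the two OPEN registered stubs are each
NECESSARY (and jointly sufficient, `SpinRatioMoebius_of` with the four landed stubs): the registered cut has no slack. -/
theorem SpinRatioMoebius_iff_openStubs :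
    Summit.CriticalPhenomena.Ising3DConformalLimit.Theses.LinkingParityCircles.SpinRatioMoebius ↔
      (Sig.stub_ratioLimitExists ∧ Sig.stub_ratioInversion) :=
  ⟨fun h => ⟨sig_ratioLimitExists_of_SpinRatioMoebius h, sig_ratioInversion_of_SpinRatioMoebius h⟩,
    fun h => SpinRatioMoebius_of h.1 h.2 stub_cellLimitTranslate stub_cellLimitContinuous stub_twoPointOfRatioLimit
      stub_scalingLimitOfRatioLimit⟩

/-- **Given Stub 1, Stub 2 ⇔ item stmt-CriticalPhenomena-4840 `CurrentConnectionInvariance.RatioInversionInvariance`**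
(⇐: Stub 9 with the GKS bound Stub 7; ⇒: through the crux, item 1344 and Stubs 11, 12, 14 — all landed). -/
theorem sig_ratioInversion_iff_CCIRatioInversion (hL : Sig.stub_ratioLimitExists) :
    Sig.stub_ratioInversion ↔ CurrentConnectionInvariance.RatioInversionInvariance :=
  ⟨fun hI => (CCI_items_of_SpinRatioMoebius stub_inversionCovariantOfInvariantRatios stub_telescopingLimitOfScalingLimit
      stub_CCIRatioRotationOfLimit stub_CCIRatioInversionOfLimit (SpinRatioMoebius_iff_openStubs.2 ⟨hL, hI⟩)).2.2,
    fun hRI => stub_ratioInversionOfCCI stub_prodPairsLe hL hRI⟩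

/-- The census of the line in the DAG of existing items, in one conjunction:
`(crux ⇔ 1344) ∧ (crux ⇔ Stub 1 ∧ Stub 2) ∧ (Stub 1 ⇔ 4841) ∧ (Stub 1 → (Stub 2 ⇔ 4840))`. -/
theorem line_census :
    (Summit.CriticalPhenomena.Ising3DConformalLimit.Theses.LinkingParityCircles.SpinRatioMoebius ↔
        EnergyNotSigmaSquared.MoebiusLimit) ∧
    (Summit.CriticalPhenomena.Ising3DConformalLimit.Theses.LinkingParityCircles.SpinRatioMoebius ↔
        (Sig.stub_ratioLimitExists ∧ Sig.stub_ratioInversion)) ∧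
    (Sig.stub_ratioLimitExists ↔ CurrentConnectionInvariance.RatioLimit) ∧
    (Sig.stub_ratioLimitExists → (Sig.stub_ratioInversion ↔ CurrentConnectionInvariance.RatioInversionInvariance)) :=
  ⟨SpinRatioMoebius_iff_moebiusLimit_stubs, SpinRatioMoebius_iff_openStubs,
    ratioLimitExists_iff_CCIRatioLimit stub_telescopingLimitOfScalingLimit, sig_ratioInversion_iff_CCIRatioInversion⟩

end Tightness

end Summit.CriticalPhenomena.Ising3DConformalLimit.Cruxes.SpinRatioMoebius.Birth

end
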